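import Mathlib
import Literature.NumberTheory.Automorphic.HigherGreenFunctionProofs2

/-!
# Higher Green functions, layer 0 (continued): `z ↦ G_s(z, z')` is `C²` and `y² Δ G_s = s(s-1) G_s`

Third proved companion file of `Literature/NumberTheory/Automorphic/HigherGreenFunction.lean`,
toward the named fact `higherGreen_isResolventGreenLike` of `HigherGreenFunctionCM.lean`
(Gross–Zagier 1986, §II.2, properties (a)–(c) of `G_s^{Γ₀(N)}`; Zhang 1997, p. 132). This file proves
property (a) for the tree's `higherGreen N s 1` in the form used there: for `s ≥ 2`, `z' ∈ ℍ` and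
`z₀ ∉ Γ₀(N) z'`, the extension `w ↦ G_s^{Γ₀(N)}(ofComplex w, z')` to `ℂ` is `C²` at `z₀` and
`(Im z₀)² Δ = s(s-1) ·` (Mathlib's Euclidean Laplacian on `ℂ = ℝ²`)
(`contDiffAt_two_laplacian_higherGreen`).

The argument is the termwise one. Each term of `G_s(z, z') = -2 Σ_{γ ∈ Γ₀(N)} Q_{s-1}(T_γ(z))`,
`T_γ(z) = cosh d(z, γz') = ((x - a)² + y² + b²)/(2yb)` (`γz' = a + ib`, `coshDistArg_eq`), is a
smooth function of `(x, y)` off `γz'`: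

* `hasFDerivAt_coshDistArgC`, `_x`, `_y`: the Fréchet derivatives of `T`, `Tₓ`, `Tᵧ` on `ℂ = ℝ²`
  (through `Complex.reCLM`, `Complex.imCLM`); `coshDistArgC_size` and `abs_coshDistArgC_*_le`: the
  bounds `|Tₓ| ≤ 2T/y`, `|Tᵧ| ≤ T/y`, `|Tₓₓ|, |Tₓᵧ|, |Tᵧᵧ| ≤ 2T/y²`; `abs_deriv_greenQ_le`,
  `abs_deriv2_greenQ_le`: `|Q'| ≤ sQ/(T-1)`, `|Q''| ≤ s(s+1)Q/(T-1)²` from the recurrences of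
  `HigherGreenFunctionProofs2.lean`;
* `hasFDerivAt_comp_plane`, `hasFDerivAt_comp_plane_deriv`, `comp_plane_deriv2_laplacian`: the chain
  rule to second order for `Q ∘ T` and its Euclidean Laplacian `Q'(T) ΔT + Q''(T) |∇T|²`;
* `contDiffOn_greenQ_coshDistArgC`, `fderiv_greenQ_coshDistArgC`, `fderiv2_greenQ_coshDistArgC`:
  the term is `C^∞` on `{Im > 0} ∖ {γz'}`, with `‖D(Q∘T)‖ ≤ 3sQ T/((T-1)y)`,
  `‖D²(Q∘T)‖ ≤ (8sQT/(T-1) + 9s(s+1)QT²/(T-1)²)/y²`, and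
  `D²[1,1] + D²[i,i] = (s-1)s Q(T)/y²` — `y²|∇T|² = T² - 1`, `y² ΔT = 2T` and Legendre's equation
  (`hasDerivAt_deriv_greenQ`), i.e. each term is an eigenfunction (Gross–Zagier §II.2 (b) for `g_s`);
* `exists_ball_majorants_fderiv_greenQ`: on a small Euclidean ball around `z₀` (of hyperbolic
  radius `< 1`, `exists_ball_subset_hyperbolic`) these bounds are dominated by summable families
  (`e⁻¹T_γ(z₀) ≤ T_γ ≤ eT_γ(z₀)` by the isometric action; monotonicity
  `greenQ_mul_div_le_of_mem_Icc`, `greenQ_mul_sq_div_le_of_mem_Icc`; `O(T_γ(z₀)^{-s})` away from the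
  finitely many near terms, `summable_inv_pow_coshDistArg`);
* `contDiffAt_two_laplacian_higherGreen`: termwise differentiation
  (`hasFDerivAt_tsum_of_isPreconnected`, once for the series and once for each scalar slice
  `v ↦ DG(v)[u]` of its derivative, `contDiffOn_clm_apply`), continuity of the second derivatives
  (`continuousOn_tsum`), and summation of the termwise eigen-equation.

## References

* B. Gross, D. Zagier, *Heegner points and derivatives of L-series*, Invent. Math. 84 (1986),
  §II.2 (properties (a)–(d) of `G_{N,s}`). [`GrossZagier1986`]
* S.-W. Zhang, *Heights of Heegner cycles and derivatives of L-series*, Invent. Math. 130 (1997),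
  p. 132 (property (a): "`G_k(z, z')` is killed by `D - k(k-1)`, `D = y²(∂²/∂x² + ∂²/∂y²)`").
  [`Zhang1997`]
* J. H. Bruinier, Y. Li, T. Yang, Forum Math. Sigma 13 (2025), arXiv:2204.10604, p. 3 ("It is an
  eigenfunction with respect to the Laplacians in `z₁` and `z₂`"). [`BruinierLiYang2025`]
-/

noncomputable section

namespace Literature.NumberTheory.Automorphic

open UpperHalfPlane Complex Real Set Filter Metric
open _root_.MeasureTheory
open scoped Real _root_.Topology UpperHalfPlane ContDiff

section TermCalculus

/-! ## The argument `T(v) = ((Re v - a)² + (Im v)² + b²)/(2 Im v · b)` as a function on `ℂ` -/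

/-- **`DT`.** For `w = a + ib` and `v = x + iy` with `y, b ≠ 0`, the function
`T(v) = ((x - a)² + y² + b²)/(2 y b)` (`= cosh d(v, w)` on `ℍ`, `coshDistArg_eq`) has Fréchet
derivative `DT(v) = Tₓ • re + Tᵧ • im` on `ℂ = ℝ²`, with `Tₓ = (x - a)/(y b)` and
`Tᵧ = (y² - (x - a)² - b²)/(2 y² b)`. [folklore] -/
theorem hasFDerivAt_coshDistArgC {a b : ℝ} (hb : b ≠ 0) {v : ℂ} (hv : v.im ≠ 0) :
    HasFDerivAt (fun v : ℂ => ((v.re - a) ^ 2 + v.im ^ 2 + b ^ 2) / (2 * v.im * b))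
      (((v.re - a) / (v.im * b)) • reCLM +
        ((v.im ^ 2 - (v.re - a) ^ 2 - b ^ 2) / (2 * v.im ^ 2 * b)) • imCLM) v := by
  have hre : HasFDerivAt (fun v : ℂ => v.re) reCLM v := reCLM.hasFDerivAt
  have him : HasFDerivAt (fun v : ℂ => v.im) imCLM v := imCLM.hasFDerivAt
  have hX : HasFDerivAt (fun v : ℂ => v.re - a) reCLM v := hre.sub_const a
  have hN : HasFDerivAt (fun v : ℂ => (v.re - a) ^ 2 + v.im ^ 2 + b ^ 2)
      ((v.re - a) • reCLM + (v.re - a) • reCLM + ((v.im • imCLM + v.im • imCLM))) v := by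
    have h1 := hX.mul hX
    have h2 := him.mul him
    have h3 := (h1.add h2).add_const (b ^ 2)
    refine h3.congr_of_eventuallyEq (Filter.Eventually.of_forall fun u => ?_) |>.congr_fderiv ?_
    · simp only [Pi.add_apply, Pi.mul_apply]; ring
    · rfl
  have hg : HasFDerivAt (fun v : ℂ => 2 * v.im * b) (b • ((2 : ℝ) • imCLM)) v :=
    (him.const_mul 2).mul_const b
  have hg0 : 2 * v.im * b ≠ 0 := by positivity
  have hinv : HasFDerivAt (fun v : ℂ => (2 * v.im * b)⁻¹)
      ((-((2 * v.im * b) ^ 2)⁻¹) • (b • ((2 : ℝ) • imCLM))) v :=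
    (hasDerivAt_inv hg0).comp_hasFDerivAt v hg
  have hT := hN.mul hinv
  have hfun : (fun v : ℂ => ((v.re - a) ^ 2 + v.im ^ 2 + b ^ 2) / (2 * v.im * b)) =
      (fun v : ℂ => (v.re - a) ^ 2 + v.im ^ 2 + b ^ 2) * fun v : ℂ => (2 * v.im * b)⁻¹ := by
    funext u
    simp only [Pi.mul_apply, div_eq_mul_inv]
  rw [hfun]
  refine hT.congr_fderiv ?_
  ext h
  simp only [_root_.add_apply, _root_.smul_apply,
    reCLM_apply, imCLM_apply, smul_eq_mul]
  field_simp
  ring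

/-- **`DTₓ`.** The `x`-partial `Tₓ(v) = (x - a)/(y b)` has Fréchet derivative
`Tₓₓ • re + Tₓᵧ • im` with `Tₓₓ = 1/(y b)`, `Tₓᵧ = -(x - a)/(y² b)` (`y, b ≠ 0`). [folklore] -/
theorem hasFDerivAt_coshDistArgC_x {a b : ℝ} (hb : b ≠ 0) {v : ℂ} (hv : v.im ≠ 0) :
    HasFDerivAt (fun v : ℂ => (v.re - a) / (v.im * b))
      ((1 / (v.im * b)) • reCLM + (-(v.re - a) / (v.im ^ 2 * b)) • imCLM) v := by
  have hre : HasFDerivAt (fun v : ℂ => v.re) reCLM v := reCLM.hasFDerivAt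
  have him : HasFDerivAt (fun v : ℂ => v.im) imCLM v := imCLM.hasFDerivAt
  have hX : HasFDerivAt (fun v : ℂ => v.re - a) reCLM v := hre.sub_const a
  have hg : HasFDerivAt (fun v : ℂ => v.im * b) (b • imCLM) v := him.mul_const b
  have hg0 : v.im * b ≠ 0 := by positivity
  have hinv : HasFDerivAt (fun v : ℂ => (v.im * b)⁻¹) ((-((v.im * b) ^ 2)⁻¹) • (b • imCLM)) v :=
    (hasDerivAt_inv hg0).comp_hasFDerivAt v hg
  have hT := hX.mul hinv
  have hfun : (fun v : ℂ => (v.re - a) / (v.im * b)) =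
      (fun v : ℂ => v.re - a) * fun v : ℂ => (v.im * b)⁻¹ := by
    funext u
    simp only [Pi.mul_apply, div_eq_mul_inv]
  rw [hfun]
  refine hT.congr_fderiv ?_
  ext h
  simp only [_root_.add_apply, _root_.smul_apply,
    reCLM_apply, imCLM_apply, smul_eq_mul]
  field_simp
  ring

/-- **`DTᵧ`.** The `y`-partial `Tᵧ(v) = (y² - (x-a)² - b²)/(2 y² b)` has Fréchet derivative
`Tₓᵧ • re + Tᵧᵧ • im` with `Tₓᵧ = -(x - a)/(y² b)`, `Tᵧᵧ = ((x - a)² + b²)/(y³ b)` (`y, b ≠ 0`).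
[folklore] -/
theorem hasFDerivAt_coshDistArgC_y {a b : ℝ} (hb : b ≠ 0) {v : ℂ} (hv : v.im ≠ 0) :
    HasFDerivAt (fun v : ℂ => (v.im ^ 2 - (v.re - a) ^ 2 - b ^ 2) / (2 * v.im ^ 2 * b))
      ((-(v.re - a) / (v.im ^ 2 * b)) • reCLM + (((v.re - a) ^ 2 + b ^ 2) / (v.im ^ 3 * b)) • imCLM)
      v := by
  have hre : HasFDerivAt (fun v : ℂ => v.re) reCLM v := reCLM.hasFDerivAt
  have him : HasFDerivAt (fun v : ℂ => v.im) imCLM v := imCLM.hasFDerivAt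
  have hX : HasFDerivAt (fun v : ℂ => v.re - a) reCLM v := hre.sub_const a
  have hN : HasFDerivAt (fun v : ℂ => v.im ^ 2 - (v.re - a) ^ 2 - b ^ 2)
      ((v.im • imCLM + v.im • imCLM) - ((v.re - a) • reCLM + (v.re - a) • reCLM)) v := by
    have h1 := hX.mul hX
    have h2 := him.mul him
    have h3 := (h2.sub h1).sub_const (b ^ 2)
    refine (h3.congr_of_eventuallyEq (Filter.Eventually.of_forall fun u => ?_)).congr_fderiv rfl
    simp only [Pi.sub_apply, Pi.mul_apply]
    ring
  have hg : HasFDerivAt (fun v : ℂ => 2 * v.im ^ 2 * b)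
      (b • ((2 : ℝ) • (v.im • imCLM + v.im • imCLM))) v := by
    have h2 := him.mul him
    have h3 := (h2.const_mul (2 : ℝ)).mul_const b
    refine h3.congr_of_eventuallyEq (Filter.Eventually.of_forall fun u => ?_)
    simp only [Pi.mul_apply]
    ring
  have hg0 : 2 * v.im ^ 2 * b ≠ 0 := by positivity
  have hinv : HasFDerivAt (fun v : ℂ => (2 * v.im ^ 2 * b)⁻¹)
      ((-((2 * v.im ^ 2 * b) ^ 2)⁻¹) • (b • ((2 : ℝ) • (v.im • imCLM + v.im • imCLM)))) v :=
    (hasDerivAt_inv hg0).comp_hasFDerivAt v hg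
  have hT := hN.mul hinv
  have hfun : (fun v : ℂ => (v.im ^ 2 - (v.re - a) ^ 2 - b ^ 2) / (2 * v.im ^ 2 * b)) =
      (fun v : ℂ => v.im ^ 2 - (v.re - a) ^ 2 - b ^ 2) * fun v : ℂ => (2 * v.im ^ 2 * b)⁻¹ := by
    funext u
    simp only [Pi.mul_apply, div_eq_mul_inv]
  rw [hfun]
  refine hT.congr_fderiv ?_
  ext h
  simp only [_root_.add_apply, _root_.sub_apply,
    _root_.smul_apply, reCLM_apply, imCLM_apply, smul_eq_mul]
  field_simp
  ring

/-! ## Pointwise bounds on `T` and its partial derivatives in terms of `T` and `y` -/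

/-- Size relations for `T` defined by `2 y b T = (x-a)² + y² + b²` (`y, b > 0`): `1 ≤ T`,
`y ≤ 2bT`, `b ≤ 2yT`, `|x - a| ≤ 2bT`. [folklore] -/
theorem coshDistArgC_size {a b x y T : ℝ} (hb : 0 < b) (hy : 0 < y)
    (hT : 2 * y * b * T = (x - a) ^ 2 + y ^ 2 + b ^ 2) :
    1 ≤ T ∧ y ≤ 2 * b * T ∧ b ≤ 2 * y * T ∧ |x - a| ≤ 2 * b * T := by
  have hyb : 0 < y * b := mul_pos hy hb
  have h1 : 1 ≤ T := by
    by_contra h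
    push Not at h
    have : 2 * y * b * T < 2 * y * b := by nlinarith
    nlinarith [sq_nonneg (x - a), sq_nonneg (y - b)]
  have hT0 : 0 < T := by linarith
  have h2 : y ≤ 2 * b * T := by
    have h : y * y ≤ y * (2 * b * T) := by nlinarith [sq_nonneg (x - a), sq_nonneg b]
    exact le_of_mul_le_mul_left h hy
  have h3 : b ≤ 2 * y * T := by
    have h : b * b ≤ b * (2 * y * T) := by nlinarith [sq_nonneg (x - a), sq_nonneg y]
    exact le_of_mul_le_mul_left h hb
  have h4 : |x - a| ≤ 2 * b * T := by
    refine abs_le_of_sq_le_sq ?_ (by positivity)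
    have hX2 : (x - a) ^ 2 ≤ 2 * y * b * T := by nlinarith [sq_nonneg y, sq_nonneg b]
    have : 2 * y * b * T ≤ (2 * b * T) ^ 2 := by nlinarith [mul_le_mul_of_nonneg_right h2 (by positivity : (0:ℝ) ≤ 2 * b * T)]
    linarith
  exact ⟨h1, h2, h3, h4⟩

/-- `|Tₓ| ≤ 2T/y`. [folklore] -/
theorem abs_coshDistArgC_x_le {a b x y T : ℝ} (hb : 0 < b) (hy : 0 < y)
    (hT : 2 * y * b * T = (x - a) ^ 2 + y ^ 2 + b ^ 2) :
    |(x - a) / (y * b)| ≤ 2 * T / y := by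
  obtain ⟨hT1, -, -, hX⟩ := coshDistArgC_size hb hy hT
  rw [abs_div, abs_of_pos (mul_pos hy hb), div_le_div_iff₀ (mul_pos hy hb) hy]
  nlinarith [mul_le_mul_of_nonneg_right hX hy.le]

/-- `|Tᵧ| ≤ T/y`. [folklore] -/
theorem abs_coshDistArgC_y_le {a b x y T : ℝ} (hb : 0 < b) (hy : 0 < y)
    (hT : 2 * y * b * T = (x - a) ^ 2 + y ^ 2 + b ^ 2) :
    |(y ^ 2 - (x - a) ^ 2 - b ^ 2) / (2 * y ^ 2 * b)| ≤ T / y := by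
  have h2 : 0 < 2 * y ^ 2 * b := by positivity
  rw [abs_div, abs_of_pos h2, div_le_div_iff₀ h2 hy]
  have hnum : |y ^ 2 - (x - a) ^ 2 - b ^ 2| ≤ (x - a) ^ 2 + y ^ 2 + b ^ 2 := by
    rw [abs_le]
    constructor <;> nlinarith [sq_nonneg (x - a), sq_nonneg y, sq_nonneg b]
  calc |y ^ 2 - (x - a) ^ 2 - b ^ 2| * y ≤ ((x - a) ^ 2 + y ^ 2 + b ^ 2) * y :=
        mul_le_mul_of_nonneg_right hnum hy.le
    _ = T * (2 * y ^ 2 * b) := by rw [← hT]; ring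

/-- `|Tₓₓ| ≤ 2T/y²`. [folklore] -/
theorem abs_coshDistArgC_xx_le {a b x y T : ℝ} (hb : 0 < b) (hy : 0 < y)
    (hT : 2 * y * b * T = (x - a) ^ 2 + y ^ 2 + b ^ 2) :
    |1 / (y * b)| ≤ 2 * T / y ^ 2 := by
  obtain ⟨-, hy2, -, -⟩ := coshDistArgC_size hb hy hT
  rw [abs_of_pos (by positivity), div_le_div_iff₀ (by positivity) (by positivity)]
  nlinarith [mul_le_mul_of_nonneg_left hy2 hy.le]

/-- `|Tₓᵧ| ≤ 2T/y²`. [folklore] -/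
theorem abs_coshDistArgC_xy_le {a b x y T : ℝ} (hb : 0 < b) (hy : 0 < y)
    (hT : 2 * y * b * T = (x - a) ^ 2 + y ^ 2 + b ^ 2) :
    |-(x - a) / (y ^ 2 * b)| ≤ 2 * T / y ^ 2 := by
  obtain ⟨-, -, -, hX⟩ := coshDistArgC_size hb hy hT
  rw [abs_div, abs_neg, abs_of_pos (by positivity : 0 < y ^ 2 * b),
    div_le_div_iff₀ (by positivity) (by positivity)]
  nlinarith [mul_le_mul_of_nonneg_right hX (sq_nonneg y)]

/-- `|Tᵧᵧ| ≤ 2T/y²`. [folklore] -/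
theorem abs_coshDistArgC_yy_le {a b x y T : ℝ} (hb : 0 < b) (hy : 0 < y)
    (hT : 2 * y * b * T = (x - a) ^ 2 + y ^ 2 + b ^ 2) :
    |((x - a) ^ 2 + b ^ 2) / (y ^ 3 * b)| ≤ 2 * T / y ^ 2 := by
  rw [abs_of_nonneg (by positivity), div_le_div_iff₀ (by positivity) (by positivity)]
  have h1 : (x - a) ^ 2 + b ^ 2 ≤ 2 * y * b * T := by nlinarith [sq_nonneg y]
  nlinarith [mul_le_mul_of_nonneg_right h1 (sq_nonneg y)]

/-! ## Bounds for `Q_{s-1}'` and `Q_{s-1}''` -/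

/-- `|Q_{s-1}'(τ)| ≤ s Q_{s-1}(τ)/(τ - 1)` for `τ > 1`, `s ≥ 1` (from
`Q' = s(Q_s - τ Q_{s-1})/(τ² - 1)` and `0 ≤ Q_s ≤ Q_{s-1}`). [folklore] -/
theorem abs_deriv_greenQ_le {τ : ℝ} (hτ : 1 < τ) {s : ℕ} (hs : 1 ≤ s) :
    |deriv (greenQ s) τ| ≤ s * greenQ s τ / (τ - 1) := by
  rw [deriv_greenQ hτ hs]
  have hQ1 : 0 ≤ greenQ (s + 1) τ := greenQ_nonneg (by linarith) _
  have hQ : 0 ≤ greenQ s τ := greenQ_nonneg (by linarith) _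
  have hsucc : greenQ (s + 1) τ ≤ greenQ s τ :=
    (greenQ_succ_le_div hτ hs).trans (div_le_self hQ hτ.le)
  have hden : 0 < τ ^ 2 - 1 := by nlinarith
  have hs0 : (0 : ℝ) ≤ s := Nat.cast_nonneg s
  rw [abs_div, abs_of_pos hden, abs_mul, Nat.abs_cast, div_le_div_iff₀ hden (by linarith)]
  have key : |greenQ (s + 1) τ - τ * greenQ s τ| ≤ (τ + 1) * greenQ s τ := by
    rw [abs_le]
    constructor <;> nlinarith
  calc (s : ℝ) * |greenQ (s + 1) τ - τ * greenQ s τ| * (τ - 1)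
      ≤ s * ((τ + 1) * greenQ s τ) * (τ - 1) := by gcongr
    _ = s * greenQ s τ * (τ ^ 2 - 1) := by ring

/-- `|Q_{s-1}''(τ)| ≤ s(s+1) Q_{s-1}(τ)/(τ - 1)²` for `τ > 1`, `s ≥ 1`, for the value
`Q'' = (s(s-1)Q - 2τQ')/(τ² - 1)` of `hasDerivAt_deriv_greenQ`. [folklore] -/
theorem abs_deriv2_greenQ_le {τ : ℝ} (hτ : 1 < τ) {s : ℕ} (hs : 1 ≤ s) :
    |((s : ℝ) * (s - 1) * greenQ s τ - 2 * τ * deriv (greenQ s) τ) / (τ ^ 2 - 1)| ≤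
      s * (s + 1) * greenQ s τ / (τ - 1) ^ 2 := by
  have hQ : 0 ≤ greenQ s τ := greenQ_nonneg (by linarith) _
  have hden : 0 < τ ^ 2 - 1 := by nlinarith
  have hτ1 : 0 < τ - 1 := by linarith
  have hs1 : (1 : ℝ) ≤ s := by exact_mod_cast hs
  have hD := abs_deriv_greenQ_le hτ hs
  set D := deriv (greenQ s) τ with hDdef
  rw [abs_div, abs_of_pos hden, div_le_div_iff₀ hden (by positivity)]
  have hD' : |D| * (τ - 1) ≤ s * greenQ s τ := by
    rwa [le_div_iff₀ hτ1] at hD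
  have h1 : |(s : ℝ) * (s - 1) * greenQ s τ - 2 * τ * D| ≤
      s * (s - 1) * greenQ s τ + 2 * τ * |D| := by
    refine (abs_sub _ _).trans ?_
    rw [abs_of_nonneg (mul_nonneg (mul_nonneg (Nat.cast_nonneg s) (by linarith)) hQ), abs_mul,
      abs_of_pos (by linarith : (0:ℝ) < 2 * τ)]
  -- multiply `h1` by `(τ-1)²` and use `|D|(τ-1) ≤ sQ`
  have hD2 : 2 * τ * |D| * (τ - 1) ^ 2 ≤ 2 * τ * (s * greenQ s τ) * (τ - 1) := by
    have := mul_le_mul_of_nonneg_left hD' (by positivity : (0:ℝ) ≤ 2 * τ * (τ - 1))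
    nlinarith [this]
  calc |(s : ℝ) * (s - 1) * greenQ s τ - 2 * τ * D| * (τ - 1) ^ 2
      ≤ (s * (s - 1) * greenQ s τ + 2 * τ * |D|) * (τ - 1) ^ 2 :=
        mul_le_mul_of_nonneg_right h1 (by positivity)
    _ = s * (s - 1) * greenQ s τ * (τ - 1) ^ 2 + 2 * τ * |D| * (τ - 1) ^ 2 := by ring
    _ ≤ s * (s - 1) * greenQ s τ * (τ - 1) ^ 2 + 2 * τ * (s * greenQ s τ) * (τ - 1) := by
        linarith
    _ ≤ s * (s + 1) * greenQ s τ * (τ ^ 2 - 1) := by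
        nlinarith [mul_nonneg (mul_nonneg (by positivity : (0:ℝ) ≤ s) hQ) hτ1.le]

/-! ## Generic first and second derivatives of `v ↦ Q(T(v))` on `ℂ = ℝ²` -/

/-- Chain rule, first order: `D(Q ∘ T) = Q'(T) Tₓ • re + Q'(T) Tᵧ • im`. [folklore] -/
theorem hasFDerivAt_comp_plane {Q : ℝ → ℝ} {T : ℂ → ℝ} {v : ℂ} {q₁ tx ty : ℝ}
    (hQ : HasDerivAt Q q₁ (T v)) (hT : HasFDerivAt T (tx • reCLM + ty • imCLM) v) :
    HasFDerivAt (fun v => Q (T v)) ((q₁ * tx) • reCLM + (q₁ * ty) • imCLM) v := by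
  have h := hQ.comp_hasFDerivAt v hT
  simp only [Function.comp_def] at h
  refine h.congr_fderiv ?_
  rw [smul_add, smul_smul, smul_smul]

/-- Chain rule, second order: the derivative of
`v ↦ (Q'(T) Tx) • re + (Q'(T) Ty) • im` (`Q' = deriv Q`, `Tx, Ty` the partial-derivative
functions of `T`) in terms of `Q''(T)`, `DT = Tx • re + Ty • im`, `DTx = txx • re + txy • im`,
`DTy = tyx • re + tyy • im`. [folklore] -/
theorem hasFDerivAt_comp_plane_deriv {Q : ℝ → ℝ} {T Tx Ty : ℂ → ℝ} {v : ℂ}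
    {q₂ txx txy tyx tyy : ℝ} (hQ2 : HasDerivAt (deriv Q) q₂ (T v))
    (hT : HasFDerivAt T (Tx v • reCLM + Ty v • imCLM) v)
    (hTx : HasFDerivAt Tx (txx • reCLM + txy • imCLM) v)
    (hTy : HasFDerivAt Ty (tyx • reCLM + tyy • imCLM) v) :
    HasFDerivAt (fun v => (deriv Q (T v) * Tx v) • reCLM + (deriv Q (T v) * Ty v) • imCLM)
      (((deriv Q (T v) * txx + q₂ * Tx v * Tx v) • reCLM +
          (deriv Q (T v) * txy + q₂ * Tx v * Ty v) • imCLM).smulRight (reCLM : ℂ →L[ℝ] ℝ) +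
        ((deriv Q (T v) * tyx + q₂ * Ty v * Tx v) • reCLM +
          (deriv Q (T v) * tyy + q₂ * Ty v * Ty v) • imCLM).smulRight (imCLM : ℂ →L[ℝ] ℝ)) v := by
  -- `D(Q' ∘ T) = q₂ • DT`
  have hQ'T : HasFDerivAt (fun v => deriv Q (T v)) ((q₂ * Tx v) • reCLM + (q₂ * Ty v) • imCLM) v :=
    hasFDerivAt_comp_plane hQ2 hT
  have hα := (hQ'T.mul hTx).smul_const (reCLM : ℂ →L[ℝ] ℝ)
  have hβ := (hQ'T.mul hTy).smul_const (imCLM : ℂ →L[ℝ] ℝ)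
  refine (hα.add hβ).congr_fderiv ?_
  congr 1
  · congr 1
    ext h
    simp only [_root_.add_apply, _root_.smul_apply, reCLM_apply, imCLM_apply, smul_eq_mul]
    ring
  · congr 1
    ext h
    simp only [_root_.add_apply, _root_.smul_apply, reCLM_apply, imCLM_apply, smul_eq_mul]
    ring

/-- Norm of a covector `α • re + β • im` on `ℂ`: at most `|α| + |β|`. [folklore] -/
theorem norm_smul_reCLM_add_smul_imCLM_le (α β : ℝ) :
    ‖α • (reCLM : ℂ →L[ℝ] ℝ) + β • (imCLM : ℂ →L[ℝ] ℝ)‖ ≤ |α| + |β| := by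
  refine (norm_add_le _ _).trans ?_
  rw [norm_smul, norm_smul, reCLM_norm, imCLM_norm, mul_one, mul_one, Real.norm_eq_abs,
    Real.norm_eq_abs]

/-- Norm of `L₁.smulRight re + L₂.smulRight im`: at most `‖L₁‖ + ‖L₂‖`. [folklore] -/
theorem norm_smulRight_reCLM_add_smulRight_imCLM_le (L₁ L₂ : ℂ →L[ℝ] ℝ) :
    ‖L₁.smulRight (reCLM : ℂ →L[ℝ] ℝ) + L₂.smulRight (imCLM : ℂ →L[ℝ] ℝ)‖ ≤ ‖L₁‖ + ‖L₂‖ := by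
  refine (norm_add_le (L₁.smulRight (reCLM : ℂ →L[ℝ] ℝ)) (L₂.smulRight (imCLM : ℂ →L[ℝ] ℝ))).trans ?_
  rw [ContinuousLinearMap.norm_smulRight_apply, ContinuousLinearMap.norm_smulRight_apply,
    reCLM_norm, imCLM_norm, mul_one, mul_one]

/-- The Euclidean Laplacian `D²[1,1] + D²[i,i]` of the second derivative of
`hasFDerivAt_comp_plane_deriv`: `Q'(T)(txx + tyy) + Q''(T)(Tx² + Ty²)`. [folklore] -/
theorem comp_plane_deriv2_laplacian (d q₂ Txv Tyv txx txy tyx tyy : ℝ) :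
    (((d * txx + q₂ * Txv * Txv) • (reCLM : ℂ →L[ℝ] ℝ) +
          (d * txy + q₂ * Txv * Tyv) • (imCLM : ℂ →L[ℝ] ℝ)).smulRight (reCLM : ℂ →L[ℝ] ℝ) +
        ((d * tyx + q₂ * Tyv * Txv) • (reCLM : ℂ →L[ℝ] ℝ) +
          (d * tyy + q₂ * Tyv * Tyv) • (imCLM : ℂ →L[ℝ] ℝ)).smulRight (imCLM : ℂ →L[ℝ] ℝ))
        (1 : ℂ) (1 : ℂ) +
      (((d * txx + q₂ * Txv * Txv) • (reCLM : ℂ →L[ℝ] ℝ) +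
          (d * txy + q₂ * Txv * Tyv) • (imCLM : ℂ →L[ℝ] ℝ)).smulRight (reCLM : ℂ →L[ℝ] ℝ) +
        ((d * tyx + q₂ * Tyv * Txv) • (reCLM : ℂ →L[ℝ] ℝ) +
          (d * tyy + q₂ * Tyv * Tyv) • (imCLM : ℂ →L[ℝ] ℝ)).smulRight (imCLM : ℂ →L[ℝ] ℝ))
        Complex.I Complex.I =
      d * (txx + tyy) + q₂ * (Txv ^ 2 + Tyv ^ 2) := by
  simp only [_root_.add_apply, _root_.smul_apply, ContinuousLinearMap.smulRight_apply,
    reCLM_apply, imCLM_apply, smul_eq_mul, Complex.one_re, Complex.one_im, Complex.I_re,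
    Complex.I_im]
  ring

/-! ## The term `k(v) = Q_{s-1}(T(v))`: smoothness off `w`, derivative bounds, Laplacian -/

/-- Off `w = a + ib` (and on `{Im > 0}`), `T > 1`: `T - 1 = |v - w|²/(2 y b)`. [folklore] -/
theorem one_lt_coshDistArgC {a b : ℝ} (hb : 0 < b) {v : ℂ} (hv : 0 < v.im) (hne : v ≠ ⟨a, b⟩) :
    1 < ((v.re - a) ^ 2 + v.im ^ 2 + b ^ 2) / (2 * v.im * b) := by
  rw [lt_div_iff₀ (by positivity)]
  have hne' : (v.re - a) ^ 2 + (v.im - b) ^ 2 ≠ 0 := by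
    intro h
    apply hne
    have h1 : v.re - a = 0 := by nlinarith [sq_nonneg (v.re - a), sq_nonneg (v.im - b)]
    have h2 : v.im - b = 0 := by nlinarith [sq_nonneg (v.re - a), sq_nonneg (v.im - b)]
    exact Complex.ext (by simp; linarith) (by simp; linarith)
  have hpos : 0 < (v.re - a) ^ 2 + (v.im - b) ^ 2 :=
    lt_of_le_of_ne (add_nonneg (sq_nonneg _) (sq_nonneg _)) (Ne.symm hne')
  nlinarith

/-- `{Im > 0} ∖ {w}` is open. [folklore] -/
theorem isOpen_upperHalfPlane_diff_singleton (w : ℂ) : IsOpen ({v : ℂ | 0 < v.im} \ {w}) :=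
  (isOpen_lt continuous_const Complex.continuous_im).sdiff isClosed_singleton

/-- `v ↦ Q_{s-1}(T(v))` is `C^∞` on `{Im > 0} ∖ {w}` (`s ≥ 1`): `T` is a rational function with
non-vanishing denominator there, with values in `(1, ∞)`, where `Q_{s-1}` is smooth
(`contDiffOn_greenQ`). [folklore] -/
theorem contDiffOn_greenQ_coshDistArgC {a b : ℝ} (hb : 0 < b) {s : ℕ} (hs : 1 ≤ s) :
    ContDiffOn ℝ ∞ (fun v : ℂ => greenQ s (((v.re - a) ^ 2 + v.im ^ 2 + b ^ 2) / (2 * v.im * b)))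
      ({v : ℂ | 0 < v.im} \ {⟨a, b⟩}) := by
  have hE : ContDiffOn ℝ ∞ (fun v : ℂ => ((v.re - a) ^ 2 + v.im ^ 2 + b ^ 2) / (2 * v.im * b))
      ({v : ℂ | 0 < v.im} \ {⟨a, b⟩}) := by
    refine ContDiffOn.div ?_ ?_ fun v hv => ?_
    · exact ((((reCLM.contDiff.sub contDiff_const).pow 2).add (imCLM.contDiff.pow 2)).add
        contDiff_const).contDiffOn
    · exact ((contDiff_const.mul imCLM.contDiff).mul contDiff_const).contDiffOn
    · have : 0 < v.im := hv.1
      positivity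
  have hmaps : MapsTo (fun v : ℂ => ((v.re - a) ^ 2 + v.im ^ 2 + b ^ 2) / (2 * v.im * b))
      ({v : ℂ | 0 < v.im} \ {⟨a, b⟩}) (Ioi 1) := fun v hv =>
    one_lt_coshDistArgC hb hv.1 (by simpa using hv.2)
  exact (contDiffOn_greenQ hs).comp hE hmaps

/-- **First derivative of the term.** For `v ∈ {Im > 0} ∖ {w}`: `k = Q_{s-1} ∘ T` is
differentiable at `v` and `‖Dk(v)‖ ≤ 3 s Q_{s-1}(T) T/((T - 1) y)` (`|Q'| ≤ sQ/(T-1)`,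
`|Tₓ| + |Tᵧ| ≤ 3T/y`). [folklore] -/
theorem fderiv_greenQ_coshDistArgC {a b : ℝ} (hb : 0 < b) {s : ℕ} (hs : 1 ≤ s) {v : ℂ}
    (hv : 0 < v.im) (hne : v ≠ ⟨a, b⟩) :
    HasFDerivAt (fun v : ℂ => greenQ s (((v.re - a) ^ 2 + v.im ^ 2 + b ^ 2) / (2 * v.im * b)))
      (fderiv ℝ (fun v : ℂ => greenQ s (((v.re - a) ^ 2 + v.im ^ 2 + b ^ 2) / (2 * v.im * b))) v)
      v ∧
    fderiv ℝ (fun v : ℂ => greenQ s (((v.re - a) ^ 2 + v.im ^ 2 + b ^ 2) / (2 * v.im * b))) v =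
      (deriv (greenQ s) (((v.re - a) ^ 2 + v.im ^ 2 + b ^ 2) / (2 * v.im * b)) *
          ((v.re - a) / (v.im * b))) • reCLM +
        (deriv (greenQ s) (((v.re - a) ^ 2 + v.im ^ 2 + b ^ 2) / (2 * v.im * b)) *
          ((v.im ^ 2 - (v.re - a) ^ 2 - b ^ 2) / (2 * v.im ^ 2 * b))) • imCLM ∧
    ‖fderiv ℝ (fun v : ℂ => greenQ s (((v.re - a) ^ 2 + v.im ^ 2 + b ^ 2) / (2 * v.im * b))) v‖ ≤
      3 * s * greenQ s (((v.re - a) ^ 2 + v.im ^ 2 + b ^ 2) / (2 * v.im * b)) *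
        (((v.re - a) ^ 2 + v.im ^ 2 + b ^ 2) / (2 * v.im * b)) /
        ((((v.re - a) ^ 2 + v.im ^ 2 + b ^ 2) / (2 * v.im * b) - 1) * v.im) := by
  have hT1 := one_lt_coshDistArgC hb hv hne
  have h := hasFDerivAt_comp_plane (hasDerivAt_greenQ hT1 hs).differentiableAt.hasDerivAt
    (hasFDerivAt_coshDistArgC (a := a) hb.ne' hv.ne')
  refine ⟨h.differentiableAt.hasFDerivAt, h.fderiv, ?_⟩
  rw [h.fderiv]
  refine (norm_smul_reCLM_add_smul_imCLM_le _ _).trans ?_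
  rw [abs_mul, abs_mul]
  set T : ℝ := ((v.re - a) ^ 2 + v.im ^ 2 + b ^ 2) / (2 * v.im * b) with hT
  have hTrel : 2 * v.im * b * T = (v.re - a) ^ 2 + v.im ^ 2 + b ^ 2 := by
    rw [hT]; field_simp
  have hx := abs_coshDistArgC_x_le hb hv hTrel
  have hy := abs_coshDistArgC_y_le hb hv hTrel
  have hQ' := abs_deriv_greenQ_le hT1 hs
  have hQ0 : 0 ≤ greenQ s T := greenQ_nonneg (by linarith) s
  have hT0 : 0 < T - 1 := by linarith
  have hb0 : 0 ≤ (s : ℝ) * greenQ s T / (T - 1) := by positivity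
  calc |deriv (greenQ s) T| * |(v.re - a) / (v.im * b)| +
        |deriv (greenQ s) T| * |(v.im ^ 2 - (v.re - a) ^ 2 - b ^ 2) / (2 * v.im ^ 2 * b)|
      = |deriv (greenQ s) T| *
          (|(v.re - a) / (v.im * b)| + |(v.im ^ 2 - (v.re - a) ^ 2 - b ^ 2) / (2 * v.im ^ 2 * b)|) := by
        ring
    _ ≤ ((s : ℝ) * greenQ s T / (T - 1)) * (2 * T / v.im + T / v.im) :=
        mul_le_mul hQ' (add_le_add hx hy) (by positivity) hb0
    _ = 3 * s * greenQ s T * T / ((T - 1) * v.im) := by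
        field_simp
        ring

/-- **Second derivative of the term.** For `v ∈ {Im > 0} ∖ {w}`: `Dk` is differentiable at `v`
with `‖D²k(v)‖ ≤ (8 s Q T/(T-1) + 9 s(s+1) Q T²/(T-1)²)/y²` (`Q = Q_{s-1}(T)`), and the Euclidean
Laplacian of the term is `D²k(v)[1,1] + D²k(v)[i,i] = (s-1)s Q_{s-1}(T)/y²`, i.e.
`y² Δ k = s(s-1) k`: the chain rule with `y²|∇T|² = T² - 1`, `y² ΔT = 2T` and Legendre's equation
(`hasDerivAt_deriv_greenQ`). [folklore] -/
theorem fderiv2_greenQ_coshDistArgC {a b : ℝ} (hb : 0 < b) {s : ℕ} (hs : 1 ≤ s) {v : ℂ}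
    (hv : 0 < v.im) (hne : v ≠ ⟨a, b⟩) :
    HasFDerivAt
        (fderiv ℝ (fun v : ℂ => greenQ s (((v.re - a) ^ 2 + v.im ^ 2 + b ^ 2) / (2 * v.im * b))))
        (fderiv ℝ (fderiv ℝ
          (fun v : ℂ => greenQ s (((v.re - a) ^ 2 + v.im ^ 2 + b ^ 2) / (2 * v.im * b)))) v) v ∧
    ‖fderiv ℝ (fderiv ℝ
        (fun v : ℂ => greenQ s (((v.re - a) ^ 2 + v.im ^ 2 + b ^ 2) / (2 * v.im * b)))) v‖ ≤
      (8 * s * greenQ s (((v.re - a) ^ 2 + v.im ^ 2 + b ^ 2) / (2 * v.im * b)) *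
          (((v.re - a) ^ 2 + v.im ^ 2 + b ^ 2) / (2 * v.im * b)) /
          (((v.re - a) ^ 2 + v.im ^ 2 + b ^ 2) / (2 * v.im * b) - 1) +
        9 * s * (s + 1) * greenQ s (((v.re - a) ^ 2 + v.im ^ 2 + b ^ 2) / (2 * v.im * b)) *
          (((v.re - a) ^ 2 + v.im ^ 2 + b ^ 2) / (2 * v.im * b)) ^ 2 /
          (((v.re - a) ^ 2 + v.im ^ 2 + b ^ 2) / (2 * v.im * b) - 1) ^ 2) / v.im ^ 2 ∧
    fderiv ℝ (fderiv ℝ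
        (fun v : ℂ => greenQ s (((v.re - a) ^ 2 + v.im ^ 2 + b ^ 2) / (2 * v.im * b)))) v 1 1 +
      fderiv ℝ (fderiv ℝ
        (fun v : ℂ => greenQ s (((v.re - a) ^ 2 + v.im ^ 2 + b ^ 2) / (2 * v.im * b)))) v
        Complex.I Complex.I =
      ((s : ℝ) - 1) * s * greenQ s (((v.re - a) ^ 2 + v.im ^ 2 + b ^ 2) / (2 * v.im * b)) /
        v.im ^ 2 := by
  have hT1 := one_lt_coshDistArgC hb hv hne
  -- the explicit first derivative near `v`
  have hU : {u : ℂ | 0 < u.im} \ {⟨a, b⟩} ∈ 𝓝 v :=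
    (isOpen_upperHalfPlane_diff_singleton _).mem_nhds ⟨hv, by simpa using hne⟩
  have hfd : fderiv ℝ (fun v : ℂ => greenQ s (((v.re - a) ^ 2 + v.im ^ 2 + b ^ 2) / (2 * v.im * b)))
      =ᶠ[𝓝 v] fun v => (deriv (greenQ s) (((v.re - a) ^ 2 + v.im ^ 2 + b ^ 2) / (2 * v.im * b)) *
          ((v.re - a) / (v.im * b))) • reCLM +
        (deriv (greenQ s) (((v.re - a) ^ 2 + v.im ^ 2 + b ^ 2) / (2 * v.im * b)) *
          ((v.im ^ 2 - (v.re - a) ^ 2 - b ^ 2) / (2 * v.im ^ 2 * b))) • imCLM :=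
    Filter.eventually_of_mem hU fun u hu =>
      (fderiv_greenQ_coshDistArgC hb hs hu.1 (by simpa using hu.2)).2.1
  -- the explicit second derivative at `v`
  have hQ2 := hasDerivAt_deriv_greenQ hT1 hs
  have h2 := hasFDerivAt_comp_plane_deriv (Q := greenQ s)
    (T := fun v : ℂ => ((v.re - a) ^ 2 + v.im ^ 2 + b ^ 2) / (2 * v.im * b))
    (Tx := fun v : ℂ => (v.re - a) / (v.im * b))
    (Ty := fun v : ℂ => (v.im ^ 2 - (v.re - a) ^ 2 - b ^ 2) / (2 * v.im ^ 2 * b))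
    hQ2 (hasFDerivAt_coshDistArgC hb.ne' hv.ne') (hasFDerivAt_coshDistArgC_x hb.ne' hv.ne')
    (hasFDerivAt_coshDistArgC_y hb.ne' hv.ne')
  have h2' := h2.congr_of_eventuallyEq hfd
  refine ⟨h2'.fderiv ▸ h2'.differentiableAt.hasFDerivAt, ?_, ?_⟩
  · -- the norm bound
    rw [h2'.fderiv]
    set T : ℝ := ((v.re - a) ^ 2 + v.im ^ 2 + b ^ 2) / (2 * v.im * b) with hT
    have hTrel : 2 * v.im * b * T = (v.re - a) ^ 2 + v.im ^ 2 + b ^ 2 := by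
      rw [hT]; field_simp
    have hx := abs_coshDistArgC_x_le hb hv hTrel
    have hy := abs_coshDistArgC_y_le hb hv hTrel
    have hxx := abs_coshDistArgC_xx_le hb hv hTrel
    have hxy := abs_coshDistArgC_xy_le hb hv hTrel
    have hyy := abs_coshDistArgC_yy_le hb hv hTrel
    have hQ' := abs_deriv_greenQ_le hT1 hs
    have hQ'' := abs_deriv2_greenQ_le hT1 hs
    have hQ0 : 0 ≤ greenQ s T := greenQ_nonneg (by linarith) s
    have hT0 : 0 < T - 1 := by linarith
    set D₁ := deriv (greenQ s) T with hD₁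
    set D₂ := ((s : ℝ) * (s - 1) * greenQ s T - 2 * T * D₁) / (T ^ 2 - 1) with hD₂
    set tx := (v.re - a) / (v.im * b) with htx
    set ty := (v.im ^ 2 - (v.re - a) ^ 2 - b ^ 2) / (2 * v.im ^ 2 * b) with hty
    set txx := 1 / (v.im * b) with htxx
    set txy := -(v.re - a) / (v.im ^ 2 * b) with htxy
    set tyy := ((v.re - a) ^ 2 + b ^ 2) / (v.im ^ 3 * b) with htyy
    refine (norm_smulRight_reCLM_add_smulRight_imCLM_le _ _).trans ?_
    have hL₁ := norm_smul_reCLM_add_smul_imCLM_le (D₁ * txx + D₂ * tx * tx) (D₁ * txy + D₂ * tx * ty)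
    have hL₂ := norm_smul_reCLM_add_smul_imCLM_le (D₁ * txy + D₂ * ty * tx) (D₁ * tyy + D₂ * ty * ty)
    refine (add_le_add hL₁ hL₂).trans ?_
    have hA : 0 ≤ (s : ℝ) * greenQ s T / (T - 1) := by positivity
    have hB : 0 ≤ (s : ℝ) * (s + 1) * greenQ s T / (T - 1) ^ 2 := by positivity
    have e1 : |D₁ * txx + D₂ * tx * tx| ≤
        (s * greenQ s T / (T - 1)) * (2 * T / v.im ^ 2) +
          (s * (s + 1) * greenQ s T / (T - 1) ^ 2) * (2 * T / v.im) * (2 * T / v.im) := by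
      refine (abs_add_le _ _).trans (add_le_add ?_ ?_)
      · rw [abs_mul]; exact mul_le_mul hQ' hxx (abs_nonneg _) hA
      · rw [abs_mul, abs_mul]
        exact mul_le_mul (mul_le_mul hQ'' hx (abs_nonneg _) hB) hx (abs_nonneg _) (by positivity)
    have e2 : |D₁ * txy + D₂ * tx * ty| ≤
        (s * greenQ s T / (T - 1)) * (2 * T / v.im ^ 2) +
          (s * (s + 1) * greenQ s T / (T - 1) ^ 2) * (2 * T / v.im) * (T / v.im) := by
      refine (abs_add_le _ _).trans (add_le_add ?_ ?_)
      · rw [abs_mul]; exact mul_le_mul hQ' hxy (abs_nonneg _) hA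
      · rw [abs_mul, abs_mul]
        exact mul_le_mul (mul_le_mul hQ'' hx (abs_nonneg _) hB) hy (abs_nonneg _) (by positivity)
    have e3 : |D₁ * txy + D₂ * ty * tx| ≤
        (s * greenQ s T / (T - 1)) * (2 * T / v.im ^ 2) +
          (s * (s + 1) * greenQ s T / (T - 1) ^ 2) * (T / v.im) * (2 * T / v.im) := by
      refine (abs_add_le _ _).trans (add_le_add ?_ ?_)
      · rw [abs_mul]; exact mul_le_mul hQ' hxy (abs_nonneg _) hA
      · rw [abs_mul, abs_mul]
        exact mul_le_mul (mul_le_mul hQ'' hy (abs_nonneg _) hB) hx (abs_nonneg _) (by positivity)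
    have e4 : |D₁ * tyy + D₂ * ty * ty| ≤
        (s * greenQ s T / (T - 1)) * (2 * T / v.im ^ 2) +
          (s * (s + 1) * greenQ s T / (T - 1) ^ 2) * (T / v.im) * (T / v.im) := by
      refine (abs_add_le _ _).trans (add_le_add ?_ ?_)
      · rw [abs_mul]; exact mul_le_mul hQ' hyy (abs_nonneg _) hA
      · rw [abs_mul, abs_mul]
        exact mul_le_mul (mul_le_mul hQ'' hy (abs_nonneg _) hB) hy (abs_nonneg _) (by positivity)
    refine (add_le_add (add_le_add e1 e2) (add_le_add e3 e4)).trans (le_of_eq ?_)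
    have hy0 : v.im ≠ 0 := hv.ne'
    field_simp
    ring
  · -- the Laplacian of the term
    rw [h2'.fderiv, comp_plane_deriv2_laplacian]
    set T : ℝ := ((v.re - a) ^ 2 + v.im ^ 2 + b ^ 2) / (2 * v.im * b) with hT
    have hden : T ^ 2 - 1 ≠ 0 := by nlinarith
    have hQ2eq : ((s : ℝ) * (s - 1) * greenQ s T - 2 * T * deriv (greenQ s) T) / (T ^ 2 - 1) *
        (T ^ 2 - 1) = (s : ℝ) * (s - 1) * greenQ s T - 2 * T * deriv (greenQ s) T := by
      field_simp
    have hy0 : v.im ≠ 0 := hv.ne'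
    have hb0 : b ≠ 0 := hb.ne'
    have id1 : v.im ^ 2 * (((v.re - a) / (v.im * b)) ^ 2 +
        ((v.im ^ 2 - (v.re - a) ^ 2 - b ^ 2) / (2 * v.im ^ 2 * b)) ^ 2) = T ^ 2 - 1 := by
      rw [hT]; field_simp; ring
    have id2 : v.im ^ 2 * (1 / (v.im * b) + ((v.re - a) ^ 2 + b ^ 2) / (v.im ^ 3 * b)) = 2 * T := by
      rw [hT]; field_simp; ring
    rw [eq_div_iff (pow_ne_zero 2 hy0)]
    linear_combination deriv (greenQ s) T * id2 +
      ((s : ℝ) * (s - 1) * greenQ s T - 2 * T * deriv (greenQ s) T) / (T ^ 2 - 1) * id1 + hQ2eq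

/-! ## Interval majorants: the derivative bounds are controlled by the left endpoint -/

/-- On `1 < ℓ ≤ T ≤ L`: `Q(T) T/(T-1) ≤ Q(ℓ) L/(ℓ-1)` (`Q = Q_{s-1}` is decreasing). [folklore] -/
theorem greenQ_mul_div_le_of_mem_Icc {s : ℕ} (hs : 1 ≤ s) {ℓ L T : ℝ} (hℓ : 1 < ℓ) (hℓT : ℓ ≤ T)
    (hTL : T ≤ L) :
    greenQ s T * T / (T - 1) ≤ greenQ s ℓ * L / (ℓ - 1) := by
  have hT1 : 1 < T := by linarith
  have hQT : greenQ s T ≤ greenQ s ℓ := greenQ_antitoneOn hs (mem_Ioi.mpr hℓ) (mem_Ioi.mpr hT1) hℓT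
  have hQ0 : 0 ≤ greenQ s T := greenQ_nonneg (by linarith) s
  have hQℓ0 : 0 ≤ greenQ s ℓ := greenQ_nonneg (by linarith) s
  rw [div_le_div_iff₀ (by linarith) (by linarith)]
  have h1 : greenQ s T * T ≤ greenQ s ℓ * L := mul_le_mul hQT hTL (by linarith) hQℓ0
  exact mul_le_mul h1 (by linarith) (by linarith) (mul_nonneg hQℓ0 (by linarith))

/-- On `1 < ℓ ≤ T ≤ L`: `Q(T) T²/(T-1)² ≤ Q(ℓ) L²/(ℓ-1)²`. [folklore] -/
theorem greenQ_mul_sq_div_le_of_mem_Icc {s : ℕ} (hs : 1 ≤ s) {ℓ L T : ℝ} (hℓ : 1 < ℓ) (hℓT : ℓ ≤ T)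
    (hTL : T ≤ L) :
    greenQ s T * T ^ 2 / (T - 1) ^ 2 ≤ greenQ s ℓ * L ^ 2 / (ℓ - 1) ^ 2 := by
  have hT1 : 1 < T := by linarith
  have hQT : greenQ s T ≤ greenQ s ℓ := greenQ_antitoneOn hs (mem_Ioi.mpr hℓ) (mem_Ioi.mpr hT1) hℓT
  have hQ0 : 0 ≤ greenQ s T := greenQ_nonneg (by linarith) s
  have hQℓ0 : 0 ≤ greenQ s ℓ := greenQ_nonneg (by linarith) s
  rw [div_le_div_iff₀ (by positivity) (by positivity)]
  have h1 : greenQ s T * T ^ 2 ≤ greenQ s ℓ * L ^ 2 :=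
    mul_le_mul hQT (pow_le_pow_left₀ (by linarith) hTL 2) (by positivity) hQℓ0
  have h2 : (ℓ - 1) ^ 2 ≤ (T - 1) ^ 2 := pow_le_pow_left₀ (by linarith) (by linarith) 2
  exact mul_le_mul h1 h2 (by positivity) (by positivity)

/-- Away from the singularity the majorants are `O(ℓ^{-s})`: for `ℓ ≥ 2` and `L ≤ c ℓ`,
`Q(ℓ) L/(ℓ-1) ≤ (2c · 4^s/s) ℓ^{-s}` and `Q(ℓ) L²/(ℓ-1)² ≤ (4c² · 4^s/s) ℓ^{-s}`. [folklore] -/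
theorem greenQ_majorant_le_of_two_le {s : ℕ} (hs : 1 ≤ s) {ℓ L c : ℝ} (hℓ : 2 ≤ ℓ) (hc : 0 ≤ c)
    (hL : L ≤ c * ℓ) (hL0 : 0 ≤ L) :
    greenQ s ℓ * L / (ℓ - 1) ≤ 2 * c * (4 ^ s / s) * (ℓ ^ s)⁻¹ ∧
    greenQ s ℓ * L ^ 2 / (ℓ - 1) ^ 2 ≤ 4 * c ^ 2 * (4 ^ s / s) * (ℓ ^ s)⁻¹ := by
  have hQ := greenQ_le_of_two_le hℓ hs
  have hQ0 : 0 ≤ greenQ s ℓ := greenQ_nonneg (by linarith) s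
  have hℓ1 : 0 < ℓ - 1 := by linarith
  have hpow : 0 < (ℓ ^ s)⁻¹ := by positivity
  have h1 : L / (ℓ - 1) ≤ 2 * c := by
    rw [div_le_iff₀ hℓ1]; nlinarith
  have h2 : L ^ 2 / (ℓ - 1) ^ 2 ≤ 4 * c ^ 2 := by
    rw [div_le_iff₀ (by positivity)]
    have : L ≤ 2 * c * (ℓ - 1) := by nlinarith
    nlinarith [mul_le_mul this this hL0 (by positivity)]
  constructor
  · calc greenQ s ℓ * L / (ℓ - 1) = greenQ s ℓ * (L / (ℓ - 1)) := by ring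
      _ ≤ (4 ^ s / s * (ℓ ^ s)⁻¹) * (2 * c) :=
          mul_le_mul hQ h1 (div_nonneg hL0 hℓ1.le) (by positivity)
      _ = 2 * c * (4 ^ s / s) * (ℓ ^ s)⁻¹ := by ring
  · calc greenQ s ℓ * L ^ 2 / (ℓ - 1) ^ 2 = greenQ s ℓ * (L ^ 2 / (ℓ - 1) ^ 2) := by ring
      _ ≤ (4 ^ s / s * (ℓ ^ s)⁻¹) * (4 * c ^ 2) :=
          mul_le_mul hQ h2 (by positivity) (by positivity)
      _ = 4 * c ^ 2 * (4 ^ s / s) * (ℓ ^ s)⁻¹ := by ring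

/-! ## A Euclidean ball around `z₀ ∈ ℍ` of small hyperbolic radius -/

/-- For `z₀ ∈ ℍ` and `δ > 0` there is a Euclidean radius `r > 0` such that every `v` with
`|v - z₀| < r` has `Im v ≥ Im z₀/2 > 0` and hyperbolic distance `d(v, z₀) ≤ δ`
(`d ≤ |v - z₀|/√(Im v Im z₀)`, `UpperHalfPlane.dist_le_dist_coe_div_sqrt`). [folklore] -/
theorem exists_ball_subset_hyperbolic (z₀ : ℍ) {δ : ℝ} (hδ : 0 < δ) :
    ∃ r : ℝ, 0 < r ∧ ∀ v : ℂ, dist v (z₀ : ℂ) < r →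
      z₀.im / 2 ≤ v.im ∧ ∀ hv : 0 < v.im, dist (⟨v, hv⟩ : ℍ) z₀ ≤ δ := by
  have hy := z₀.im_pos
  refine ⟨min (z₀.im / 2) (δ * z₀.im / 2), by positivity, fun v hv => ?_⟩
  have hr1 : dist v (z₀ : ℂ) < z₀.im / 2 := lt_of_lt_of_le hv (min_le_left _ _)
  have hr2 : dist v (z₀ : ℂ) < δ * z₀.im / 2 := lt_of_lt_of_le hv (min_le_right _ _)
  have him : z₀.im / 2 ≤ v.im := by
    have h := Complex.abs_im_le_norm (v - z₀)
    rw [Complex.sub_im, UpperHalfPlane.coe_im] at h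
    rw [Complex.dist_eq] at hr1
    have := (abs_sub_lt_iff.mp (lt_of_le_of_lt h hr1)).2
    linarith
  refine ⟨him, fun hv0 => ?_⟩
  have hd := UpperHalfPlane.dist_le_dist_coe_div_sqrt (⟨v, hv0⟩ : ℍ) z₀
  refine hd.trans ?_
  have hprod : z₀.im ^ 2 / 2 ≤ v.im * z₀.im := by nlinarith
  have hsqrt : z₀.im / 2 ≤ √(v.im * z₀.im) := by
    rw [Real.le_sqrt (by positivity) (by positivity)]
    nlinarith
  have hsqrt0 : 0 < √(v.im * z₀.im) := Real.sqrt_pos.mpr (by positivity)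
  change dist v (z₀ : ℂ) / √(v.im * z₀.im) ≤ δ
  rw [div_le_iff₀ hsqrt0]
  nlinarith [mul_le_mul_of_nonneg_left hsqrt hδ.le]

end TermCalculus

section Series

open Literature.NumberTheory.EllipticCurves.ModularForms (intGL)

/-! ## Uniform majorants for the term derivatives on a small ball around `z₀ ∉ Γ₀(N) z'` -/

set_option maxHeartbeats 400000 in
/-- **Summable majorants for `Dk_γ`, `D²k_γ` near `z₀`.** Let `s ≥ 2`, `z' ∈ ℍ` and `z₀ ∈ ℍ` off
the orbit points `γ z'`, `γ ∈ R_N^{(1)} = Γ₀(N)`. There are a Euclidean ball `B` around `z₀`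
inside `{Im > 0}` and summable families `M₁, M₂` such that on `B` the first and second Fréchet
derivatives of every term `k_γ(v) = Q_{s-1}(T_γ(v))`, `T_γ(v) = cosh d(v, γ z')` written in
coordinates, are bounded by `M₁ γ`, `M₂ γ` (Weierstrass `M`-test data): on `B`,
`e⁻¹ T_γ(z₀) ≤ T_γ(v) ≤ e T_γ(z₀)` (isometric action, `d(v, z₀) < 1`), the bounds
`fderiv_greenQ_coshDistArgC`, `fderiv2_greenQ_coshDistArgC` are monotone in these brackets
(`greenQ_mul_div_le_of_mem_Icc`, `greenQ_mul_sq_div_le_of_mem_Icc`), and away from the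
finitely many `γ` with `T_γ(z₀) ≤ 2e` they are `O(T_γ(z₀)^{-s})`, which is summable
(`summable_inv_pow_coshDistArg`). [folklore] -/
theorem exists_ball_majorants_fderiv_greenQ {N : ℕ} {s : ℕ} (hs : 2 ≤ s) {z₀ z' : ℍ}
    (h : ¬ OnHeckeCorrespondence N 1 z₀ z') :
    ∃ r : ℝ, 0 < r ∧ ∃ M₁ M₂ : heckeMatrices N 1 → ℝ, Summable M₁ ∧ Summable M₂ ∧
      ∀ v : ℂ, dist v (z₀ : ℂ) < r → 0 < v.im ∧ ∀ γ : heckeMatrices N 1,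
        v ≠ (⟨((intGL (γ : Matrix (Fin 2) (Fin 2) ℤ) • z' : ℍ) : ℂ).re,
              ((intGL (γ : Matrix (Fin 2) (Fin 2) ℤ) • z' : ℍ) : ℂ).im⟩ : ℂ) ∧
        ‖fderiv ℝ (fun v : ℂ => greenQ s
            (((v.re - ((intGL (γ : Matrix (Fin 2) (Fin 2) ℤ) • z' : ℍ) : ℂ).re) ^ 2 + v.im ^ 2 +
                ((intGL (γ : Matrix (Fin 2) (Fin 2) ℤ) • z' : ℍ) : ℂ).im ^ 2) /
              (2 * v.im * ((intGL (γ : Matrix (Fin 2) (Fin 2) ℤ) • z' : ℍ) : ℂ).im))) v‖ ≤ M₁ γ ∧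
        ‖fderiv ℝ (fderiv ℝ (fun v : ℂ => greenQ s
            (((v.re - ((intGL (γ : Matrix (Fin 2) (Fin 2) ℤ) • z' : ℍ) : ℂ).re) ^ 2 + v.im ^ 2 +
                ((intGL (γ : Matrix (Fin 2) (Fin 2) ℤ) • z' : ℍ) : ℂ).im ^ 2) /
              (2 * v.im * ((intGL (γ : Matrix (Fin 2) (Fin 2) ℤ) • z' : ℍ) : ℂ).im)))) v‖ ≤ M₂ γ := by
  have hy := z₀.im_pos
  have hs1 : 1 ≤ s := by omega
  -- notation: the orbit points `w γ`, the arguments at `z₀`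
  set w : heckeMatrices N 1 → ℍ := fun γ => intGL (γ : Matrix (Fin 2) (Fin 2) ℤ) • z' with hw_def
  set T₀ : heckeMatrices N 1 → ℝ := fun γ =>
    1 + dist (z₀ : ℂ) ((w γ : ℍ) : ℂ) ^ 2 / (2 * z₀.im * (w γ).im) with hT₀_def
  -- the coordinate expression agrees with `coshDistArg` on `ℍ`
  have hTC : ∀ γ (v : ℂ) (hv : 0 < v.im),
      ((v.re - ((w γ : ℍ) : ℂ).re) ^ 2 + v.im ^ 2 + ((w γ : ℍ) : ℂ).im ^ 2) /
          (2 * v.im * ((w γ : ℍ) : ℂ).im) =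
        1 + dist (((⟨v, hv⟩ : ℍ) : ℂ)) ((w γ : ℍ) : ℂ) ^ 2 / (2 * (⟨v, hv⟩ : ℍ).im * (w γ).im) := by
    intro γ v hv
    rw [coshDistArg_eq]
    rfl
  have hT₀1 : ∀ γ, 1 < T₀ γ := by
    intro γ
    have hne : (z₀ : ℂ) ≠ ((w γ : ℍ) : ℂ) := fun heq => h ⟨γ, γ.2, (UpperHalfPlane.ext heq).symm⟩
    have hd := dist_pos.mpr hne
    have hv := (w γ).im_pos
    have : 0 < dist (z₀ : ℂ) ((w γ : ℍ) : ℂ) ^ 2 / (2 * z₀.im * (w γ).im) := by positivity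
    show 1 < 1 + _
    linarith
  -- summability at `z₀` and the finite set of `γ` near the singularity
  have hsum0 : Summable fun γ => (T₀ γ ^ s)⁻¹ := summable_inv_pow_coshDistArg one_pos hs z₀ z'
  have hfin : {γ : heckeMatrices N 1 | T₀ γ ≤ 2 * Real.exp 1}.Finite := by
    have hpos : (0 : ℝ) < ((2 * Real.exp 1) ^ s)⁻¹ := by positivity
    have hev := hsum0.tendsto_cofinite_zero.eventually (gt_mem_nhds hpos)
    refine (Filter.eventually_cofinite.mp hev).subset fun γ hγ => ?_
    simp only [Set.mem_setOf_eq, not_lt] at hγ ⊢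
    exact inv_anti₀ (by have := hT₀1 γ; positivity)
      (pow_le_pow_left₀ (by linarith [hT₀1 γ]) hγ s)
  set S₀ := hfin.toFinset with hS₀
  have hmemS₀ : ∀ γ, γ ∈ S₀ ↔ T₀ γ ≤ 2 * Real.exp 1 := fun γ => by
    rw [hS₀, Set.Finite.mem_toFinset, Set.mem_setOf_eq]
  -- thresholds `τ γ = (1 + T₀ γ)/2` for the finitely many near terms
  set τ : heckeMatrices N 1 → ℝ := fun γ => (1 + T₀ γ) / 2 with hτ_def
  have hτ1 : ∀ γ, 1 < τ γ := fun γ => by simp only [hτ_def]; linarith [hT₀1 γ]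
  have hτT : ∀ γ, τ γ < T₀ γ := fun γ => by simp only [hτ_def]; linarith [hT₀1 γ]
  -- continuity of the coordinate expressions at `z₀`
  have hcontC : ∀ γ, ContinuousAt (fun v : ℂ =>
      ((v.re - ((w γ : ℍ) : ℂ).re) ^ 2 + v.im ^ 2 + ((w γ : ℍ) : ℂ).im ^ 2) /
        (2 * v.im * ((w γ : ℍ) : ℂ).im)) (z₀ : ℂ) := by
    intro γ
    have hb : ((w γ : ℍ) : ℂ).im ≠ 0 := by rw [UpperHalfPlane.coe_im]; exact (w γ).im_pos.ne'
    have hy0 : (z₀ : ℂ).im ≠ 0 := by rw [UpperHalfPlane.coe_im]; exact hy.ne'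
    refine ContinuousAt.div (by fun_prop) (by fun_prop) ?_
    positivity
  -- the ball
  obtain ⟨r₁, hr₁, hball₁⟩ := exists_ball_subset_hyperbolic z₀ one_pos
  have hnear : ∀ᶠ v in 𝓝 (z₀ : ℂ), ∀ γ ∈ S₀, τ γ <
      ((v.re - ((w γ : ℍ) : ℂ).re) ^ 2 + v.im ^ 2 + ((w γ : ℍ) : ℂ).im ^ 2) /
        (2 * v.im * ((w γ : ℍ) : ℂ).im) := by
    refine (Filter.eventually_all_finset S₀).mpr fun γ _ => ?_
    refine continuousAt_const.eventually_lt (hcontC γ) ?_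
    -- at `z₀` the coordinate expression is `T₀ γ`
    have : ((((z₀ : ℂ)).re - ((w γ : ℍ) : ℂ).re) ^ 2 + (z₀ : ℂ).im ^ 2 + ((w γ : ℍ) : ℂ).im ^ 2) /
        (2 * (z₀ : ℂ).im * ((w γ : ℍ) : ℂ).im) = T₀ γ := by
      rw [hTC γ (z₀ : ℂ) (by rw [UpperHalfPlane.coe_im]; exact hy)]
    rw [this]
    exact hτT γ
  obtain ⟨r₂, hr₂, hball₂⟩ := Metric.eventually_nhds_iff.mp hnear
  refine ⟨min r₁ r₂, lt_min hr₁ hr₂, ?_⟩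
  -- the majorants
  set M₁ : heckeMatrices N 1 → ℝ := fun γ => 6 * s / z₀.im *
    ((S₀ : Set (heckeMatrices N 1)).indicator
        (fun γ => greenQ s (τ γ) * (Real.exp 1 * T₀ γ) / (τ γ - 1)) γ +
      2 * Real.exp 1 ^ 2 * (4 ^ s / s) * (Real.exp 1 ^ s * (T₀ γ ^ s)⁻¹)) with hM₁
  set M₂ : heckeMatrices N 1 → ℝ := fun γ => 4 / z₀.im ^ 2 *
    (8 * s * ((S₀ : Set (heckeMatrices N 1)).indicator
        (fun γ => greenQ s (τ γ) * (Real.exp 1 * T₀ γ) / (τ γ - 1)) γ +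
      2 * Real.exp 1 ^ 2 * (4 ^ s / s) * (Real.exp 1 ^ s * (T₀ γ ^ s)⁻¹)) +
     9 * s * (s + 1) * ((S₀ : Set (heckeMatrices N 1)).indicator
        (fun γ => greenQ s (τ γ) * (Real.exp 1 * T₀ γ) ^ 2 / (τ γ - 1) ^ 2) γ +
      4 * (Real.exp 1 ^ 2) ^ 2 * (4 ^ s / s) * (Real.exp 1 ^ s * (T₀ γ ^ s)⁻¹))) with hM₂
  have hsumA : Summable fun γ => (S₀ : Set (heckeMatrices N 1)).indicator
      (fun γ => greenQ s (τ γ) * (Real.exp 1 * T₀ γ) / (τ γ - 1)) γ +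
      2 * Real.exp 1 ^ 2 * (4 ^ s / s) * (Real.exp 1 ^ s * (T₀ γ ^ s)⁻¹) := by
    refine Summable.add ?_ ?_
    · refine summable_of_ne_finset_zero (s := S₀) fun γ hγ => ?_
      exact Set.indicator_of_notMem (by simpa using hγ) _
    · exact ((hsum0.mul_left _).mul_left _)
  have hsumB : Summable fun γ => (S₀ : Set (heckeMatrices N 1)).indicator
      (fun γ => greenQ s (τ γ) * (Real.exp 1 * T₀ γ) ^ 2 / (τ γ - 1) ^ 2) γ +
      4 * (Real.exp 1 ^ 2) ^ 2 * (4 ^ s / s) * (Real.exp 1 ^ s * (T₀ γ ^ s)⁻¹) := by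
    refine Summable.add ?_ ?_
    · refine summable_of_ne_finset_zero (s := S₀) fun γ hγ => ?_
      exact Set.indicator_of_notMem (by simpa using hγ) _
    · exact ((hsum0.mul_left _).mul_left _)
  refine ⟨M₁, M₂, hsumA.mul_left _, ((hsumA.mul_left _).add (hsumB.mul_left _)).mul_left _, ?_⟩
  intro v hv
  have hv₁ : dist v (z₀ : ℂ) < r₁ := lt_of_lt_of_le hv (min_le_left _ _)
  have hv₂ : dist v (z₀ : ℂ) < r₂ := lt_of_lt_of_le hv (min_le_right _ _)
  obtain ⟨him, hdist⟩ := hball₁ v hv₁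
  have hv0 : 0 < v.im := by linarith
  have hd1 : dist (⟨v, hv0⟩ : ℍ) z₀ ≤ 1 := hdist hv0
  refine ⟨hv0, fun γ => ?_⟩
  have hb : 0 < ((w γ : ℍ) : ℂ).im := by rw [UpperHalfPlane.coe_im]; exact (w γ).im_pos
  -- the argument at `v` and its bracket
  set T : ℝ := ((v.re - ((w γ : ℍ) : ℂ).re) ^ 2 + v.im ^ 2 + ((w γ : ℍ) : ℂ).im ^ 2) /
    (2 * v.im * ((w γ : ℍ) : ℂ).im) with hT
  clear_value T
  have hTv : T = 1 + dist (((⟨v, hv0⟩ : ℍ) : ℂ)) ((w γ : ℍ) : ℂ) ^ 2 /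
      (2 * (⟨v, hv0⟩ : ℍ).im * (w γ).im) := hT.trans (hTC γ v hv0)
  have hτv : γ ∈ S₀ → τ γ < T := fun hγ => by rw [hT]; exact hball₂ hv₂ γ hγ
  have hup : T ≤ Real.exp 1 * T₀ γ := by
    rw [hTv]
    have hc := coshDistArg_le_exp_mul₂ one_pos γ.2 z₀ ⟨v, hv0⟩ z' z'
    rw [dist_self, add_zero] at hc
    have hd1' : dist z₀ (⟨v, hv0⟩ : ℍ) ≤ 1 := by rwa [dist_comm]
    exact hc.trans (mul_le_mul_of_nonneg_right (Real.exp_le_exp.mpr hd1')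
      (by linarith [hT₀1 γ]))
  have hlow : T₀ γ ≤ Real.exp 1 * T := by
    rw [hTv]
    have hc := coshDistArg_le_exp_mul₂ one_pos γ.2 ⟨v, hv0⟩ z₀ z' z'
    rw [dist_self, add_zero] at hc
    refine hc.trans (mul_le_mul_of_nonneg_right (Real.exp_le_exp.mpr hd1) ?_)
    have := one_le_coshDistArg (⟨v, hv0⟩ : ℍ) (w γ)
    linarith
  have he : 0 < Real.exp 1 := Real.exp_pos 1
  have he1 : 1 ≤ Real.exp 1 := Real.one_le_exp one_pos.le
  -- `v` is not the orbit point (`T₀ γ > 1` forces `T > 1`)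
  have hT1 : 1 < T := by
    by_cases hγ : γ ∈ S₀
    · exact lt_trans (hτ1 γ) (hτv hγ)
    · rw [hmemS₀, not_le] at hγ
      nlinarith
  have hne : v ≠ (⟨((w γ : ℍ) : ℂ).re, ((w γ : ℍ) : ℂ).im⟩ : ℂ) := by
    intro heq
    have h1 : T = 1 := by
      rw [hT, heq]
      simp only [sub_self]
      field_simp
      ring
    linarith
  refine ⟨hne, ?_, ?_⟩
  · -- first derivative
    have hD := (fderiv_greenQ_coshDistArgC hb hs1 hv0 hne).2.2
    refine hD.trans ?_
    rw [← hT]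
    -- `3 s Q(T) T/((T-1) y) ≤ 6s/y₀ · majorant`
    have hy2 : z₀.im / 2 ≤ v.im := him
    have hQ0 : 0 ≤ greenQ s T := greenQ_nonneg (by linarith) s
    have hmaj : greenQ s T * T / (T - 1) ≤
        (S₀ : Set (heckeMatrices N 1)).indicator
          (fun γ => greenQ s (τ γ) * (Real.exp 1 * T₀ γ) / (τ γ - 1)) γ +
        2 * Real.exp 1 ^ 2 * (4 ^ s / s) * (Real.exp 1 ^ s * (T₀ γ ^ s)⁻¹) := by
      have hfar0 : 0 ≤ 2 * Real.exp 1 ^ 2 * (4 ^ s / s) * (Real.exp 1 ^ s * (T₀ γ ^ s)⁻¹) := by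
        have := hT₀1 γ; positivity
      by_cases hγ : γ ∈ S₀
      · have hmem : γ ∈ (S₀ : Set (heckeMatrices N 1)) := hγ
        rw [Set.indicator_of_mem hmem]
        have := greenQ_mul_div_le_of_mem_Icc hs1 (hτ1 γ) (hτv hγ).le hup
        linarith
      · have hmem : γ ∉ (S₀ : Set (heckeMatrices N 1)) := hγ
        rw [Set.indicator_of_notMem hmem, zero_add]
        rw [hmemS₀, not_le] at hγ
        -- `ℓ = e⁻¹ T₀ γ ≥ 2`, `L = e T₀ γ = e² ℓ`
        have hℓ2 : 2 ≤ (Real.exp 1)⁻¹ * T₀ γ := by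
          rw [le_inv_mul_iff₀ he]; linarith
        have hℓT : (Real.exp 1)⁻¹ * T₀ γ ≤ T := by
          rw [inv_mul_le_iff₀ he]; linarith
        have h1 := greenQ_mul_div_le_of_mem_Icc hs1 (by linarith) hℓT hup
        have h2 := (greenQ_majorant_le_of_two_le hs1 hℓ2 (L := Real.exp 1 * T₀ γ)
          (c := Real.exp 1 ^ 2) (by positivity) (le_of_eq (by field_simp))
          (by have := hT₀1 γ; positivity)).1
        refine h1.trans (h2.trans (le_of_eq ?_))
        rw [mul_pow, inv_pow, mul_inv, inv_inv]
    calc 3 * s * greenQ s T * T / ((T - 1) * v.im)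
        = 3 * s / v.im * (greenQ s T * T / (T - 1)) := by
          rw [div_mul_eq_div_div]
          ring
      _ ≤ 6 * s / z₀.im * (greenQ s T * T / (T - 1)) := by
          refine mul_le_mul_of_nonneg_right ?_ (div_nonneg (mul_nonneg hQ0 (by linarith)) (by linarith))
          rw [div_le_div_iff₀ hv0 hy]
          nlinarith [Nat.cast_nonneg (α := ℝ) s]
      _ ≤ M₁ γ := by
          simp only [hM₁]
          exact mul_le_mul_of_nonneg_left hmaj (by positivity)
  · -- second derivative
    have hD := (fderiv2_greenQ_coshDistArgC hb hs1 hv0 hne).2.1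
    refine hD.trans ?_
    rw [← hT]
    have hQ0 : 0 ≤ greenQ s T := greenQ_nonneg (by linarith) s
    have hmaj1 : greenQ s T * T / (T - 1) ≤
        (S₀ : Set (heckeMatrices N 1)).indicator
          (fun γ => greenQ s (τ γ) * (Real.exp 1 * T₀ γ) / (τ γ - 1)) γ +
        2 * Real.exp 1 ^ 2 * (4 ^ s / s) * (Real.exp 1 ^ s * (T₀ γ ^ s)⁻¹) := by
      have hfar0 : 0 ≤ 2 * Real.exp 1 ^ 2 * (4 ^ s / s) * (Real.exp 1 ^ s * (T₀ γ ^ s)⁻¹) := by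
        have := hT₀1 γ; positivity
      by_cases hγ : γ ∈ S₀
      · have hmem : γ ∈ (S₀ : Set (heckeMatrices N 1)) := hγ
        rw [Set.indicator_of_mem hmem]
        have := greenQ_mul_div_le_of_mem_Icc hs1 (hτ1 γ) (hτv hγ).le hup
        linarith
      · have hmem : γ ∉ (S₀ : Set (heckeMatrices N 1)) := hγ
        rw [Set.indicator_of_notMem hmem, zero_add]
        rw [hmemS₀, not_le] at hγ
        have hℓ2 : 2 ≤ (Real.exp 1)⁻¹ * T₀ γ := by
          rw [le_inv_mul_iff₀ he]; linarith
        have hℓT : (Real.exp 1)⁻¹ * T₀ γ ≤ T := by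
          rw [inv_mul_le_iff₀ he]; linarith
        have h1 := greenQ_mul_div_le_of_mem_Icc hs1 (by linarith) hℓT hup
        have h2 := (greenQ_majorant_le_of_two_le hs1 hℓ2 (L := Real.exp 1 * T₀ γ)
          (c := Real.exp 1 ^ 2) (by positivity) (le_of_eq (by field_simp))
          (by have := hT₀1 γ; positivity)).1
        refine h1.trans (h2.trans (le_of_eq ?_))
        rw [mul_pow, inv_pow, mul_inv, inv_inv]
    have hmaj2 : greenQ s T * T ^ 2 / (T - 1) ^ 2 ≤
        (S₀ : Set (heckeMatrices N 1)).indicator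
          (fun γ => greenQ s (τ γ) * (Real.exp 1 * T₀ γ) ^ 2 / (τ γ - 1) ^ 2) γ +
        4 * (Real.exp 1 ^ 2) ^ 2 * (4 ^ s / s) * (Real.exp 1 ^ s * (T₀ γ ^ s)⁻¹) := by
      have hfar0 : 0 ≤ 4 * (Real.exp 1 ^ 2) ^ 2 * (4 ^ s / s) * (Real.exp 1 ^ s * (T₀ γ ^ s)⁻¹) := by
        have := hT₀1 γ; positivity
      by_cases hγ : γ ∈ S₀
      · have hmem : γ ∈ (S₀ : Set (heckeMatrices N 1)) := hγ
        rw [Set.indicator_of_mem hmem]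
        have := greenQ_mul_sq_div_le_of_mem_Icc hs1 (hτ1 γ) (hτv hγ).le hup
        linarith
      · have hmem : γ ∉ (S₀ : Set (heckeMatrices N 1)) := hγ
        rw [Set.indicator_of_notMem hmem, zero_add]
        rw [hmemS₀, not_le] at hγ
        have hℓ2 : 2 ≤ (Real.exp 1)⁻¹ * T₀ γ := by
          rw [le_inv_mul_iff₀ he]; linarith
        have hℓT : (Real.exp 1)⁻¹ * T₀ γ ≤ T := by
          rw [inv_mul_le_iff₀ he]; linarith
        have h1 := greenQ_mul_sq_div_le_of_mem_Icc hs1 (by linarith) hℓT hup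
        have h2 := (greenQ_majorant_le_of_two_le hs1 hℓ2 (L := Real.exp 1 * T₀ γ)
          (c := Real.exp 1 ^ 2) (by positivity) (le_of_eq (by field_simp))
          (by have := hT₀1 γ; positivity)).2
        refine h1.trans (h2.trans (le_of_eq ?_))
        rw [mul_pow, inv_pow, mul_inv, inv_inv]
    have hy2 : z₀.im / 2 ≤ v.im := him
    have hiy : 1 / v.im ^ 2 ≤ 4 / z₀.im ^ 2 := by
      rw [div_le_div_iff₀ (by positivity) (by positivity)]
      nlinarith [mul_le_mul hy2 hy2 (by positivity) hv0.le]
    have hnn1 : 0 ≤ greenQ s T * T / (T - 1) := div_nonneg (mul_nonneg hQ0 (by linarith)) (by linarith)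
    have hnn2 : 0 ≤ greenQ s T * T ^ 2 / (T - 1) ^ 2 := by positivity
    have h8 : (0 : ℝ) ≤ 8 * s := by positivity
    have h9 : (0 : ℝ) ≤ 9 * s * (s + 1) := by positivity
    have h4 : (0 : ℝ) ≤ 4 / z₀.im ^ 2 := by positivity
    calc (8 * s * greenQ s T * T / (T - 1) + 9 * s * (s + 1) * greenQ s T * T ^ 2 / (T - 1) ^ 2) /
          v.im ^ 2
        = 1 / v.im ^ 2 * (8 * s * (greenQ s T * T / (T - 1)) +
            9 * s * (s + 1) * (greenQ s T * T ^ 2 / (T - 1) ^ 2)) := by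
          ring
      _ ≤ 4 / z₀.im ^ 2 * (8 * s * (greenQ s T * T / (T - 1)) +
            9 * s * (s + 1) * (greenQ s T * T ^ 2 / (T - 1) ^ 2)) :=
          mul_le_mul_of_nonneg_right hiy (add_nonneg (mul_nonneg h8 hnn1) (mul_nonneg h9 hnn2))
      _ ≤ M₂ γ := by
          simp only [hM₂]
          exact mul_le_mul_of_nonneg_left (add_le_add (mul_le_mul_of_nonneg_left hmaj1 h8)
            (mul_le_mul_of_nonneg_left hmaj2 h9)) h4

/-- `‖c • L‖ ≤ |c| ‖L‖` for an operator with values in covectors (through the operator norm;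
avoids the `NormSMulClass` instance on the iterated operator space). [folklore] -/
theorem norm_smul_clm₂_le (c : ℝ) (L : ℂ →L[ℝ] ℂ →L[ℝ] ℝ) : ‖c • L‖ ≤ |c| * ‖L‖ :=
  ContinuousLinearMap.opNorm_le_bound _ (by positivity) fun x => by
    rw [_root_.smul_apply, norm_smul, Real.norm_eq_abs, mul_assoc]
    exact mul_le_mul_of_nonneg_left (L.le_opNorm x) (abs_nonneg c)

/-! ## `z ↦ G_s(z, z')` is `C²` through `ofComplex` and `y² Δ G_s(·, z') = s(s-1) G_s(·, z')` -/

open Laplacian in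
/-- **Property (a) of Gross–Zagier for `G_s^{Γ₀(N)}` and `C²`-regularity.** Let `s ≥ 2`, `z' ∈ ℍ`
and `z₀ ∈ ℍ` not of the form `γ z'`, `γ ∈ Γ₀(N)`. Then the extension
`F(w) = G_s^{Γ₀(N)}(ofComplex w, z')` of `z ↦ G_s^{Γ₀(N)}(z, z') = -2 Σ_γ Q_{s-1}(cosh d(z, γz'))` to
`ℂ` is `C²` at `z₀` (as a function of two real variables) and
`(Im z₀)² · Δ F(z₀) = s(s-1) G_s^{Γ₀(N)}(z₀, z')` for the Euclidean Laplacian `Δ` of Mathlib, i.e.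
`y²(∂²/∂x² + ∂²/∂y²) G_s = s(s-1) G_s` in the first variable (Gross–Zagier 1986, §II.2 (a); Zhang
1997, p. 132 (a); eigenvalue `s(1-s)` of `-y²(∂ₓ² + ∂ᵧ²)` in Bruinier–Li–Yang 2025, p. 3): the
series of terms and of their first and second derivatives converge locally uniformly near `z₀`
(`exists_ball_majorants_fderiv_greenQ`), so it may be differentiated termwise twice
(`hasFDerivAt_tsum_of_isPreconnected`), and each term satisfies the equation
(`fderiv2_greenQ_coshDistArgC`). [cite: GrossZagier1986, §II.2 (a)] -/
theorem contDiffAt_two_laplacian_higherGreen {N : ℕ} {s : ℕ} (hs : 2 ≤ s) {z₀ z' : ℍ}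
    (h : ¬ OnHeckeCorrespondence N 1 z₀ z') :
    ContDiffAt ℝ 2 (fun w : ℂ => higherGreen N s 1 (ofComplex w) z') (z₀ : ℂ) ∧
    z₀.im ^ 2 * (Δ (fun w : ℂ => higherGreen N s 1 (ofComplex w) z')) (z₀ : ℂ) =
      (s : ℝ) * ((s : ℝ) - 1) * higherGreen N s 1 z₀ z' := by
  have hy := z₀.im_pos
  have hs1 : 1 ≤ s := by omega
  -- notation: the terms `k γ`, `f γ = -2 k γ` and their derivatives
  set k : heckeMatrices N 1 → ℂ → ℝ := fun γ v => greenQ s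
    (((v.re - ((intGL (γ : Matrix (Fin 2) (Fin 2) ℤ) • z' : ℍ) : ℂ).re) ^ 2 + v.im ^ 2 +
        ((intGL (γ : Matrix (Fin 2) (Fin 2) ℤ) • z' : ℍ) : ℂ).im ^ 2) /
      (2 * v.im * ((intGL (γ : Matrix (Fin 2) (Fin 2) ℤ) • z' : ℍ) : ℂ).im)) with hk_def
  obtain ⟨r, hr, M₁, M₂, hM₁, hM₂, hB⟩ := exists_ball_majorants_fderiv_greenQ hs h
  have hB' : ∀ v : ℂ, dist v (z₀ : ℂ) < r → 0 < v.im ∧ ∀ γ : heckeMatrices N 1,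
      v ≠ (⟨((intGL (γ : Matrix (Fin 2) (Fin 2) ℤ) • z' : ℍ) : ℂ).re,
            ((intGL (γ : Matrix (Fin 2) (Fin 2) ℤ) • z' : ℍ) : ℂ).im⟩ : ℂ) ∧
      ‖fderiv ℝ (k γ) v‖ ≤ M₁ γ ∧ ‖fderiv ℝ (fderiv ℝ (k γ)) v‖ ≤ M₂ γ := hB
  clear hB
  set f : heckeMatrices N 1 → ℂ → ℝ := fun γ v => -2 * k γ v with hf_def
  set f' : heckeMatrices N 1 → ℂ → (ℂ →L[ℝ] ℝ) := fun γ v => (-2 : ℝ) • fderiv ℝ (k γ) v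
    with hf'_def
  set f'' : heckeMatrices N 1 → ℂ → (ℂ →L[ℝ] ℂ →L[ℝ] ℝ) := fun γ v =>
    (-2 : ℝ) • fderiv ℝ (fderiv ℝ (k γ)) v with hf''_def
  set B : Set ℂ := Metric.ball (z₀ : ℂ) r with hB_def
  have hBo : IsOpen B := Metric.isOpen_ball
  have hBc : IsPreconnected B := (convex_ball (z₀ : ℂ) r).isPreconnected
  have hz₀B : (z₀ : ℂ) ∈ B := Metric.mem_ball_self hr
  have hBnhds : B ∈ 𝓝 (z₀ : ℂ) := hBo.mem_nhds hz₀B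
  have hb : ∀ γ : heckeMatrices N 1, 0 < ((intGL (γ : Matrix (Fin 2) (Fin 2) ℤ) • z' : ℍ) : ℂ).im :=
    fun γ => by rw [UpperHalfPlane.coe_im]; exact UpperHalfPlane.im_pos _
  -- the coordinate expression is `coshDistArg` on `ℍ`
  have hTC : ∀ (γ : heckeMatrices N 1) (v : ℂ) (hv : 0 < v.im),
      1 + dist (((⟨v, hv⟩ : ℍ) : ℂ)) ((intGL (γ : Matrix (Fin 2) (Fin 2) ℤ) • z' : ℍ) : ℂ) ^ 2 /
          (2 * (⟨v, hv⟩ : ℍ).im * (intGL (γ : Matrix (Fin 2) (Fin 2) ℤ) • z' : ℍ).im) =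
        ((v.re - ((intGL (γ : Matrix (Fin 2) (Fin 2) ℤ) • z' : ℍ) : ℂ).re) ^ 2 + v.im ^ 2 +
            ((intGL (γ : Matrix (Fin 2) (Fin 2) ℤ) • z' : ℍ) : ℂ).im ^ 2) /
          (2 * v.im * ((intGL (γ : Matrix (Fin 2) (Fin 2) ℤ) • z' : ℍ) : ℂ).im) := by
    intro γ v hv
    rw [coshDistArg_eq]
    rfl
  -- the series on `{Im > 0}` is the higher Green function
  have hseries : ∀ v : ℂ, ∀ hv : 0 < v.im,
      higherGreen N s 1 (ofComplex v) z' = ∑' γ, f γ v := by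
    intro v hv
    rw [ofComplex_apply_of_im_pos hv, higherGreen, ← tsum_mul_left]
    refine tsum_congr fun γ => ?_
    rw [hTC γ v hv]
  -- termwise derivatives on `B`
  have hderiv1 : ∀ γ, ∀ v ∈ B, HasFDerivAt (f γ) (f' γ v) v := by
    intro γ v hv
    obtain ⟨hv0, hγ⟩ := hB' v hv
    obtain ⟨hne, -, -⟩ := hγ γ
    exact (fderiv_greenQ_coshDistArgC (hb γ) hs1 hv0 hne).1.const_mul (-2 : ℝ)
  have hbound1 : ∀ γ, ∀ v ∈ B, ‖f' γ v‖ ≤ 2 * M₁ γ := by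
    intro γ v hv
    obtain ⟨hv0, hγ⟩ := hB' v hv
    obtain ⟨-, h1, -⟩ := hγ γ
    have : ‖f' γ v‖ = 2 * ‖fderiv ℝ (k γ) v‖ := by
      rw [hf'_def]
      simp only [norm_smul, Real.norm_eq_abs]
      norm_num
    rw [this]
    linarith
  have hderiv2 : ∀ γ, ∀ v ∈ B, HasFDerivAt (f' γ) (f'' γ v) v := by
    intro γ v hv
    obtain ⟨hv0, hγ⟩ := hB' v hv
    obtain ⟨hne, -, -⟩ := hγ γ
    exact (fderiv2_greenQ_coshDistArgC (hb γ) hs1 hv0 hne).1.const_smul (-2 : ℝ)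
  have hbound2 : ∀ γ, ∀ v ∈ B, ‖f'' γ v‖ ≤ 2 * M₂ γ := by
    intro γ v hv
    obtain ⟨hv0, hγ⟩ := hB' v hv
    obtain ⟨-, -, h2⟩ := hγ γ
    have : ‖f'' γ v‖ ≤ 2 * ‖fderiv ℝ (fderiv ℝ (k γ)) v‖ := by
      have h := norm_smul_clm₂_le (-2 : ℝ) (fderiv ℝ (fderiv ℝ (k γ)) v)
      norm_num at h
      exact h
    linarith
  -- summability at `z₀`
  have hz₀im : 0 < (z₀ : ℂ).im := by rw [UpperHalfPlane.coe_im]; exact hy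
  have hsum0 : Summable fun γ => f γ (z₀ : ℂ) := by
    have hsum := (summable_greenQ_heckeMatrices (N := N) one_pos hs z₀ z').mul_left (-2)
    refine hsum.congr fun γ => ?_
    have := hTC γ (z₀ : ℂ) hz₀im
    rw [hf_def, hk_def]
    dsimp only
    rw [← this]
  -- first termwise differentiation
  have H1 : ∀ v ∈ B, HasFDerivAt (fun y => ∑' γ, f γ y) (∑' γ, f' γ v) v := fun v hv =>
    hasFDerivAt_tsum_of_isPreconnected (hM₁.mul_left 2) hBo hBc hderiv1 hbound1 hz₀B hsum0 hv
  have hsum1 : Summable fun γ => f' γ (z₀ : ℂ) :=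
    Summable.of_norm_bounded (hM₁.mul_left 2) fun γ => hbound1 γ _ hz₀B
  -- on `B` the derivative of the series is the series of derivatives
  have hsum1v : ∀ v ∈ B, Summable fun γ => f' γ v := fun v hv =>
    Summable.of_norm_bounded (hM₁.mul_left 2) fun γ => hbound1 γ v hv
  have hfdS : ∀ v ∈ B, fderiv ℝ (fun y => ∑' γ, f γ y) v = ∑' γ, f' γ v := fun v hv =>
    (H1 v hv).fderiv
  -- scalar slices `g u γ v = f' γ v u` and their derivatives `(apply u) ∘ f'' γ v`
  have hderiv2 : ∀ (u : ℂ) γ, ∀ v ∈ B, HasFDerivAt (fun y => f' γ y u)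
      ((ContinuousLinearMap.apply ℝ ℝ u).comp (f'' γ v)) v := by
    intro u γ v hv
    obtain ⟨hv0, hγ⟩ := hB' v hv
    obtain ⟨hne, -, -⟩ := hγ γ
    have h2 : HasFDerivAt (f' γ) (f'' γ v) v :=
      (fderiv2_greenQ_coshDistArgC (hb γ) hs1 hv0 hne).1.const_smul (-2 : ℝ)
    exact (ContinuousLinearMap.apply ℝ ℝ u).hasFDerivAt.comp v h2
  have hbound2 : ∀ (u : ℂ) γ, ∀ v ∈ B,
      ‖(ContinuousLinearMap.apply ℝ ℝ u).comp (f'' γ v)‖ ≤ ‖u‖ * (2 * M₂ γ) := by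
    intro u γ v hv
    obtain ⟨hv0, hγ⟩ := hB' v hv
    obtain ⟨-, -, h2⟩ := hγ γ
    have hn : ‖f'' γ v‖ ≤ 2 * ‖fderiv ℝ (fderiv ℝ (k γ)) v‖ := by
      have h := norm_smul_clm₂_le (-2 : ℝ) (fderiv ℝ (fderiv ℝ (k γ)) v)
      norm_num at h
      exact h
    have hM0 : 0 ≤ M₂ γ := (ContinuousLinearMap.opNorm_nonneg _).trans h2
    refine ContinuousLinearMap.opNorm_le_bound _ (by positivity) fun x => ?_
    rw [ContinuousLinearMap.comp_apply, ContinuousLinearMap.apply_apply]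
    calc ‖f'' γ v x u‖ ≤ ‖f'' γ v x‖ * ‖u‖ := (f'' γ v x).le_opNorm u
      _ ≤ ‖f'' γ v‖ * ‖x‖ * ‖u‖ :=
          mul_le_mul_of_nonneg_right ((f'' γ v).le_opNorm x) (norm_nonneg u)
      _ ≤ 2 * M₂ γ * ‖x‖ * ‖u‖ := by gcongr; linarith
      _ = ‖u‖ * (2 * M₂ γ) * ‖x‖ := by ring
  have hsumg : ∀ (u : ℂ), ∀ v ∈ B, Summable fun γ => f' γ v u := fun u v hv =>
    ((ContinuousLinearMap.apply ℝ ℝ u).summable (hsum1v v hv)).congr fun γ =>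
      ContinuousLinearMap.apply_apply _ _
  have Hg : ∀ (u : ℂ), ∀ v ∈ B, HasFDerivAt (fun y => ∑' γ, f' γ y u)
      (∑' γ, (ContinuousLinearMap.apply ℝ ℝ u).comp (f'' γ v)) v := fun u v hv =>
    hasFDerivAt_tsum_of_isPreconnected ((hM₂.mul_left 2).mul_left ‖u‖) hBo hBc (hderiv2 u)
      (hbound2 u) hz₀B (hsumg u _ hz₀B) hv
  have hsumg' : ∀ (u : ℂ), ∀ v ∈ B,
      Summable fun γ => (ContinuousLinearMap.apply ℝ ℝ u).comp (f'' γ v) := fun u v hv =>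
    Summable.of_norm_bounded ((hM₂.mul_left 2).mul_left ‖u‖) fun γ => hbound2 u γ v hv
  -- continuity of the series of second derivatives of the slices
  have hcontg : ∀ u : ℂ, ContinuousOn
      (fun y => ∑' γ, (ContinuousLinearMap.apply ℝ ℝ u).comp (f'' γ y)) B := by
    intro u
    refine continuousOn_tsum (f := fun γ y => (ContinuousLinearMap.apply ℝ ℝ u).comp (f'' γ y))
      (fun γ => ?_) ((hM₂.mul_left 2).mul_left ‖u‖) (hbound2 u)
    have hU : IsOpen ({v : ℂ | 0 < v.im} \
        {(⟨((intGL (γ : Matrix (Fin 2) (Fin 2) ℤ) • z' : ℍ) : ℂ).re,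
           ((intGL (γ : Matrix (Fin 2) (Fin 2) ℤ) • z' : ℍ) : ℂ).im⟩ : ℂ)}) :=
      isOpen_upperHalfPlane_diff_singleton _
    have hcd := contDiffOn_greenQ_coshDistArgC
      (a := ((intGL (γ : Matrix (Fin 2) (Fin 2) ℤ) • z' : ℍ) : ℂ).re) (s := s) (hb γ) hs1
    have h1 : ContDiffOn ℝ 1 (fderiv ℝ (k γ)) _ :=
      hcd.fderiv_of_isOpen hU (by norm_cast)
    have h2 : ContinuousOn (fderiv ℝ (fderiv ℝ (k γ))) _ :=
      h1.continuousOn_fderiv_of_isOpen hU le_rfl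
    have h3 : ContinuousOn (f'' γ) B := by
      refine (h2.mono fun v hv => ?_).const_smul (-2 : ℝ)
      obtain ⟨hv0, hγ⟩ := hB' v hv
      exact ⟨hv0, by simpa using (hγ γ).1⟩
    exact (ContinuousLinearMap.compL ℝ ℂ (ℂ →L[ℝ] ℝ) ℝ (ContinuousLinearMap.apply ℝ ℝ u)).continuous
      |>.comp_continuousOn h3
  -- the slices of the derivative of the series are `C¹` on `B`, so the series is `C²` at `z₀`
  have hslice : ∀ (u : ℂ), ∀ v ∈ B, (∑' γ, f' γ v) u = ∑' γ, f' γ v u := by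
    intro u v hv
    have h := ContinuousLinearMap.map_tsum (ContinuousLinearMap.apply ℝ ℝ u) (hsum1v v hv)
    rw [ContinuousLinearMap.apply_apply] at h
    rw [h]
    exact tsum_congr fun γ => ContinuousLinearMap.apply_apply _ _
  have hC1 : ContDiffOn ℝ 1 (fun y => ∑' γ, f' γ y) B := by
    rw [contDiffOn_clm_apply]
    intro u
    have hC1u : ContDiffOn ℝ 1 (fun y => ∑' γ, f' γ y u) B := by
      intro v hv
      have hv' : B ∈ 𝓝 v := hBo.mem_nhds hv
      refine ContDiffAt.contDiffWithinAt ?_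
      rw [show (1 : WithTop ℕ∞) = ((0 : ℕ) : WithTop ℕ∞) + 1 by norm_num,
        contDiffAt_succ_iff_hasFDerivAt]
      refine ⟨fun y => ∑' γ, (ContinuousLinearMap.apply ℝ ℝ u).comp (f'' γ y), ⟨B, hv', Hg u⟩, ?_⟩
      rw [Nat.cast_zero, contDiffAt_zero]
      exact ⟨B, hv', hcontg u⟩
    exact hC1u.congr fun v hv => hslice u v hv
  have hC2 : ContDiffAt ℝ 2 (fun y => ∑' γ, f γ y) (z₀ : ℂ) := by
    rw [show (2 : WithTop ℕ∞) = ((1 : ℕ) : WithTop ℕ∞) + 1 by norm_num,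
      contDiffAt_succ_iff_hasFDerivAt]
    exact ⟨fun y => ∑' γ, f' γ y, ⟨B, hBnhds, H1⟩, hC1.contDiffAt hBnhds⟩
  -- `F` agrees with the series near `z₀`
  have hFeq : (fun w : ℂ => higherGreen N s 1 (ofComplex w) z') =ᶠ[𝓝 (z₀ : ℂ)]
      fun y => ∑' γ, f γ y :=
    Filter.eventually_of_mem hBnhds fun v hv => hseries v (hB' v hv).1
  refine ⟨hC2.congr_of_eventuallyEq hFeq, ?_⟩
  -- the Laplacian
  have hΔ : (Δ (fun w : ℂ => higherGreen N s 1 (ofComplex w) z')) (z₀ : ℂ) =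
      (Δ (fun y : ℂ => ∑' γ, f γ y)) (z₀ : ℂ) :=
    (InnerProductSpace.laplacian_congr_nhds hFeq).self_of_nhds
  rw [hΔ, InnerProductSpace.laplacian_eq_iteratedFDeriv_complexPlane]
  simp only [iteratedFDeriv_two_apply, Matrix.cons_val_zero, Matrix.cons_val_one]
  -- second derivatives through the slices: `D²S(z₀)[u,u] = Σ_γ f''_γ(z₀)[u,u]`
  have hDfS : DifferentiableAt ℝ (fderiv ℝ (fun y => ∑' γ, f γ y)) (z₀ : ℂ) := by
    have hev : fderiv ℝ (fun y => ∑' γ, f γ y) =ᶠ[𝓝 (z₀ : ℂ)] fun y => ∑' γ, f' γ y :=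
      Filter.eventually_of_mem hBnhds hfdS
    exact ((hC1.differentiableOn one_ne_zero).differentiableAt hBnhds).congr_of_eventuallyEq hev
  have hD2 : ∀ u : ℂ, fderiv ℝ (fderiv ℝ (fun y => ∑' γ, f γ y)) (z₀ : ℂ) u u =
      ∑' γ, f'' γ (z₀ : ℂ) u u := by
    intro u
    -- `D²S(z₀)[u,u] = D(v ↦ DS(v)[u])(z₀)[u]`
    have h1 : fderiv ℝ (fun v => fderiv ℝ (fun y => ∑' γ, f γ y) v u) (z₀ : ℂ) u =
        fderiv ℝ (fderiv ℝ (fun y => ∑' γ, f γ y)) (z₀ : ℂ) u u := by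
      rw [fderiv_clm_apply hDfS (differentiableAt_const u)]
      simp [ContinuousLinearMap.flip_apply]
    rw [← h1]
    -- `v ↦ DS(v)[u]` is the scalar series `Σ_γ f'_γ(v)[u]` near `z₀`
    have hev : (fun v => fderiv ℝ (fun y => ∑' γ, f γ y) v u) =ᶠ[𝓝 (z₀ : ℂ)]
        fun v => ∑' γ, f' γ v u :=
      Filter.eventually_of_mem hBnhds fun v hv => by
        dsimp only
        rw [hfdS v hv, hslice u v hv]
    rw [hev.fderiv_eq, (Hg u _ hz₀B).fderiv]
    have h := ContinuousLinearMap.map_tsum (ContinuousLinearMap.apply ℝ ℝ u) (hsumg' u _ hz₀B)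
    rw [ContinuousLinearMap.apply_apply] at h
    rw [h]
    exact tsum_congr fun γ => by
      rw [ContinuousLinearMap.apply_apply, ContinuousLinearMap.comp_apply,
        ContinuousLinearMap.apply_apply]
  rw [hD2 1, hD2 Complex.I]
  have hsumE : ∀ u : ℂ, Summable fun γ => f'' γ (z₀ : ℂ) u u := by
    intro u
    have := (ContinuousLinearMap.apply ℝ ℝ u).summable (hsumg' u _ hz₀B)
    refine this.congr fun γ => ?_
    rw [ContinuousLinearMap.apply_apply, ContinuousLinearMap.comp_apply,
      ContinuousLinearMap.apply_apply]
  rw [← (hsumE 1).tsum_add (hsumE Complex.I)]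
  -- each term: `f'' 1 1 + f'' i i = ((s-1) s/y₀²) f`
  have hterm : ∀ γ, f'' γ (z₀ : ℂ) 1 1 + f'' γ (z₀ : ℂ) Complex.I Complex.I =
      ((s : ℝ) * ((s : ℝ) - 1) / z₀.im ^ 2) * f γ (z₀ : ℂ) := by
    intro γ
    obtain ⟨hv0, hγ⟩ := hB' _ hz₀B
    obtain ⟨hne, -, -⟩ := hγ γ
    have h3 := (fderiv2_greenQ_coshDistArgC (hb γ) hs1 hv0 hne).2.2
    rw [hf''_def, hf_def]
    dsimp only
    rw [_root_.smul_apply, _root_.smul_apply, _root_.smul_apply, _root_.smul_apply,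
      smul_eq_mul, smul_eq_mul, ← mul_add]
    rw [hk_def]
    dsimp only
    rw [h3, UpperHalfPlane.coe_im]
    ring
  rw [tsum_congr hterm, tsum_mul_left, ← hseries (z₀ : ℂ) hz₀im, ofComplex_apply]
  field_simp

end Series

end Literature.NumberTheory.Automorphic
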